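/-
Copyright: statement-level skeleton of a published paper (lit-balaban cell, Phase-2 proof seat p26 gen 42). No claims beyond
what the kernel checks below.
-/
import Mathlib
import Literature.MathematicalPhysics.QuantumFieldTheory.Balaban1983to89.B3Eq36TadpoleExpressions
import Literature.MathematicalPhysics.QuantumFieldTheory.Balaban1983to89.B3Sect3Graphs318
import Literature.MathematicalPhysics.QuantumFieldTheory.Balaban1983to89.B3Eq39FromFeynmanRules

/-!
# B3 — T. Bałaban, *(Higgs)₂,₃ quantum fields in a finite volume. III. Renormalization*, CMP **88** (1983) 411–445
[Balaban1983Higgs3] — p. 416 [PDF 6] **the pictures ③, ⑤, ⑥ of (1.22)** (= the pictures 2, 1, 7 of **(3.18)** p. 438 [PDF 28]: p18's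
model graphs `B3Sect3Graphs318.g318b`, `g318a`, `g318g`, identified with (1.22)'s ③⑤⑥ in p18's `B3Sect1Graphs122`) **EVALUATED BY THE
FEYNMAN RULES**: the general evaluator `B3GraphAmplitudeRules.graphAmp` (FILE 2 of this seat's evaluator lineage; FILE 1 `B3GraphAmplitude`)
RUN on the three drawings, in closed form for arbitrary model data / localization weights / line kernels / joint external field, and —
at print's data of p. 416 (*"B̃ = 0, g_k = 1"*, all bonds of `T_ε`, free propagators) — COMPARED WITH THE THIRD, FIFTH AND SIXTH DISPLAYED
TERMS OF (1.22) restated on the (Higgs)₂,₃ torus carrier: `E(③) = (1/6)·third122T`, `E(⑤) = (1/8)·fifth122T`,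
`E(⑥) = (N/(4²(2N+4)))·sixth122T` (FILE 11 of the evaluator; the tadpoles ① = `g36c`, ② = `g36b` are FILE 3 `B3Eq36TadpoleExpressions`,
④ = `g36a` is FILE 5 `B3Eq39FromFeynmanRules`)

statement-level skeleton of published theorems with citation tags; proofs where landed; nothing here is a claim about
the Yang–Mills mass gap

PDF held: `paper:balaban1983-higgs-2-3-quantum-fields-finite-volume` (journal page = PDF page + 410); the display (1.22) p. 416 [PDF 6] and
the pictures (3.18) p. 438 [PDF 28] are taken from the verified transcriptions in the headers of `B3Eq123Counterterms` (p26 g39),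
`B3Sect1Graphs122` and `B3Sect3Graphs318` (p18), read there as images on the ×2 renders
`run/shared/lean/pub/pub-balaban/b2b-balaban-ref1/pages/1983-cmp88-higgs23-III/1983-cmp88-higgs23-III-p006-x2.png` / `…-p028-x2.png`;
pp. 413–414 as in FILE 2.

CITATION HEADER (lean-in-tree rule).  lit-balaban TYPED SKELETON (HOME `run/shared/lean/pub/lit-balaban/`), PHASE 2, seat p26 gen 42
(unit `lit-balaban-p26`; the evaluator lineage FILEs 1–10: `B3GraphAmplitude` p361338, `B3GraphAmplitudeRules` p362438,
`B3Eq36TadpoleExpressions` p363523, `B3ExpansionFromFeynmanRules` p363747/p364487, `B3Eq39FromFeynmanRules` p365665,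
`B3Eq326FromFeynmanRules` p367199, `B3Eq322FromFeynmanRules` p368682, `B3GraphAmplitudeMajorant` p368098); free-target protocol G.5-34(d),
TAKING #7 (HOME/STATUS.md 2026-08-23T16:3xZ); design note `HOME/lit-balaban-p26/DESIGN-B3-evaluator.md` item 2 (*"PICTURES: the
per-picture dictionaries become instances"*).  ROWS **B3.Eq1.19-1.22** (the (1.22) cell; head `proved`, fold owner r15) and
**B3.Eq3.18-3.20** (the pictures (3.18); fold owner r15) of `HOME/lit-balaban-r15/ROWS-B3.md` — OPTIONAL located members, zero head weight;
also B3.Def@420 (*"E(G, {□(v)}, Φ, A) COMPUTED on concrete pictures"*).  CONSUMES BY NAME, nothing re-declared: p18's graphs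
`B3Sect3Graphs318.g318a/g318b/g318g` (p248469 lineage), FILE 1's `amp`, `SLeg/VLeg/OLeg`, `sPairing/vPairing`, `SLine/VLine`,
`ExtSLeg/ExtVLeg`, `spartner_eq_some_iff/_none_iff`, `vpartner_eq_some_iff`, `Pairing.isLower_iff/mate_eq/not_isLower_of_none`,
`vertexFactor/sLineFactor/vLineFactor/oLineFactor`, FILE 2's `graphAmp`, `rulesOf`, `rule16`, `rule110`, `pleg110`, `vlegs`, `basisE`,
`basisV`, `inner_basisE`, `extS`, `Model`, `Loc`, FILE 3's `basisE_eq`, `opCoeff`, `pleg110_basisE`, `sum_opCoeff`, the typer's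
`HiggsLattice.{Params, Site, PBond, ScalarField, ChargeData}`, `B3Eq18VertexExpansion.Op`.

THE PRINTED TEXT (verbatim, p. 416 [PDF 6]).  *"We have η = ε (hence L^kε = 1) and the only vertices are (1.6), (1.7) [with δm² instead of
δm²_k(x)], (1.8), and (1.10) with n′ = 0, B̃ = 0, g_k = 1 (but without any restrictions on n). The propagators are C^ε_0 for the scalar
field and C^ε = (−Δ^ε + μ₀²)^{−1} for the vector field (of course internal indices and vector indices are understood here). Let us write a
few terms of the expansion of Σ^ε:
Σ^ε(x−x′) = −4(N+2)λC^ε_0(0)δ^ε(x−x′) + e²dC^ε(0)q²δ^ε(x−x′) + (2·3/4!)de⁴ε²(C^ε(0))²q⁴δ^ε(x−x′)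
 − e²Σ_{μ=1}^d q(∂^ε_μC^ε_0∂^{ε*}_μ)(x−x′)qC^ε(x−x′) + 2de⁴q²C^ε_0(x−x′)q²(C^ε(x−x′))² + 4²(2N+4)λ²(C^ε_0(x−x′))³ + … = [seven pictures]
+ ⋯ (1.22) Here we did not write, and we will not write in the future, combinatoric factors before the graphs, understanding that they
are a part of the graphical description."*  p. 414 [PDF 4]: *"All the A′-legs are contracted, i.e. they are divided into pairs and each
pair is replaced by the corresponding propagator. Some φ′-legs are replaced by external scalar fields and the remaining are again divided
into pairs and each pair is replaced by a propagator"*.  The pictures: p18's `B3Sect1Graphs122` header — *"③ two A-tadpoles at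
(1.10)_{4,0} = `g318b`; … ⑤ two vertices (1.10)_{2,0} joined by the φ-line and both A-lines = `g318a`; ⑥ the sunset of two vertices (1.6) =
`g318g`"*.

READING (declared).  (a) The values below are what OUR evaluator (FILE 1's index form `amp` at FILE 2's polarized rules (1.6)/(1.10),
`graphAmp`) returns on p18's DRAWINGS — one labelled pairing each: ③ A′-legs `0–3`, `1–2` of (1.10)_{4,0}; ⑤ φ′-legs `0 ↔ 0`, A′-legs
`j ↔ j` of the two (1.10)_{2,0}; ⑥ φ′-legs `j ↔ j` (`j < 3`) of the two (1.6), so that the lines `0, 1` leave the SAME scalar product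
`(φ′·φ′)` of (1.6) (a closed index loop).  (b) PRINT'S DATA (§§3, 6, 9): all bonds `M.S = T_ε`, resp. `Ω₁ = T_ε`, trivial localization
weights, `g_k = 1`; the scalar line kernels `C₀ ⊗ 1_N` (`K((x,a),(x′,a′)) = [a = a′]C₀(x,x′)`: *"internal indices … understood"*), the
vector line kernels `δ_{μμ′}C(b₋,b′₋)` (diagonal in the bond directions — the READING of print's scalar kernel `C^ε` for the A-lines;
*"vector indices … understood"*); `C₀`, `C` are SUPPLIED two-point kernels (print's `C^ε_0`, `C^ε = (−Δ^ε + μ₀²)^{−1}`; their concrete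
torus instances are p37's `B3Eq122TorusPropagators`), `η = P.mesh 0` plays print's `ε`.  (c) The printed terms are RESTATED on the
(Higgs)₂,₃ torus carrier as bilinear forms in the two external fields (`third122T`, `fifth122T`, `sixth122T`: print's kernel inserted
between `φ(x)` and `φ′(x′)` and summed `Σ_{x,x′} ε^{2d}`, the lattice δ of ③ collapsing one sum), with the charge matrices as the
OPERATORS `q⁴ = q²q²` acting on `φ′` (print's T1-style `q…q`; `B3Eq123Counterterms.sig3/sig5/sig6` carry them as one real factor on the
`Setup` carrier) — «restated», not «identified»; no carrier bridge is invoked.  (d) COEFFICIENTS as the kernel finds them: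
`E(③) = (1/6)·third122T` (the picture's `1/4!` of (1.10)_{4,0} against print's `2·3/4!`), `E(⑤) = (1/8)·fifth122T` (the picture's
`(1/2!)²` against print's `2`), `E(⑥) = (N/(4²(2N+4)))·sixth122T` (the picture's `λ²·N` — the closed index loop — against print's
`4²(2N+4)λ² = (32N + 64)λ²`, a count consistent with the `4·4·3!` labelled pairings of the sunset of which `32` close an index loop and `64`
form one index chain); signs agree (`(−λ)² = λ²`, `e⁴ > 0`).  These ratios are print's *"combinatoric factors … part of the graphical
description"*; the decompositions in parentheses are this seat's reading, recorded as such.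

WHAT IS TYPED / PROVED (definitions with bodies + theorems; no `Prop` fact, no `sorry`; standard axioms; `[folklore]` kernels private).
③ (`g318b`): §1 `w3`, `sb3`, `tb3`, `sother3_none`, `sb3_cases`, `tb3_cases`, `sb3_injective`, `tb3_injective`, `instIsEmptySLine3`,
**`vother3`** (A′-leg `j ↦ 3 − j`), `vlower3_iff`, `vother3_ne_none`, `vl3a`, `vl3b`, `vl3a_ne_vl3b`, **`univ_vline3`** (TWO A′-lines),
`vmate3`, `instIsEmptyExtVLeg3`, `instIsEmptyOLeg3`, `es3`, `es3_0_ne_1`, `univ_extSLeg3`; §2 `assign3`, `assign3_sb0/sb1`, `assign3_injective`,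
`extAt3`, `extS_extAt3`, **`vlegs_basisV_four`** (`Π_{j<4} g(b₋)δ_{β_j}(b) = [b = β_j ∀j]·g(b₋)⁴`), **`graphAmp_g318b`** (`E = (e⁴η²/4!) Σ_{b∈S}
w(b) η^d g_k(b₋)⁴ Kv₀(b,b)Kv₁(b,b) Σ_{a,a′}(e_a·q⁴e_{a′})Φ((b₋,a),(b₋,a′))`), **`graphAmp_g318b_extS`** (`… [φ₀(b₋)·q⁴φ₁(b₋)]`); §3 `pairExt3`,
`pairExt3_apply`, **`third122T`**, **`graphAmp_g318b_free`** (`= (e⁴η²/4!)·d·Σ_x η^d g₀(x)g_k(x)⁴C(x,x)² φ(x)·q⁴φ′(x)`), **`graphAmp_g318b_print`**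
(`= (1/6)·third122T`).  ⑥ (`g318g`): §4 `sg`, `vx6`, `sg_cases`, `sg_injective2`, **`sother6`** (leg `j < 3` ↦ leg `j` of the other
vertex), `sother6_ext`, `sother6_none_iff`, `slower6_iff`, `l60`, `l61`, `l62`, `l6_ne`, **`univ_sline6`** (THREE φ′-lines), `smate6`,
`instIsEmptyVLeg6/OLeg6/VLine6/ExtVLeg6`, `ee6`, `ee6_0_ne_1`, `univ_extSLeg6`; §5 `sg_cases8`, **`rule16_basisE`** (the polarized (1.6) on
basis fields = Kronecker deltas, any level), `assign6`, `assign6_apply`, `assign6_injective`, `extAt6`, `assign6_ext`, `extS_extAt6`,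
**`graphAmp_g318g`** (`E = λ² Σ_{x,x′∈Ω₁} w₀(x)w₁(x′) η^{2d} Σ_{a,c,a′,c′} Ks₀((x,a),(x′,a′))Ks₁((x,a),(x′,a′))Ks₂((x,c),(x′,c′))Φ((x,c),(x′,c′))`);
§6 `pairExt6`, `pairExt6_apply`, **`sixth122T`**, **`graphAmp_g318g_extS`**, **`graphAmp_g318g_free`** (`= λ²·N·Σ_{x,x′∈Ω₁} w₀w₁ η^{2d}
C₀(x,x′)³ φ(x)·φ′(x′)`), **`graphAmp_g318g_print`** (`= (N/(4²(2N+4)))·sixth122T`).  ⑤ (`g318a`): §7 `sa5`, `va5`, `vx5`, `sa5_cases`,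
`va5_cases`, `sa5_injective2`, `va5_injective2`, **`sother5`**/`sother5_ext`/`sother5_none_iff`, **`vother5`**, `slower5_iff`, `vlower5_iff`,
`sl5`, `uniqueSLine5`, `vl5a`, `vl5b`, `vl5a_ne_vl5b`, **`univ_vline5`**, `mate5`, `instIsEmptyExtVLeg5/OLeg5`, `ee5`, `ee5_0_ne_1`,
`univ_extSLeg5`; §8 `assign5`, `assign5_apply`, `assign5_injective`, `extAt5`, `assign5_ext`, `bassign5`, `bassign5_apply`, `extS_extAt5`,
**`vlegs_basisV_two`**, **`graphAmp_g318a`** (`E = (e²/2)² Σ_{b,b′∈S} w₀(b)w₁(b′) η^{2d} g_k(b₋)²g_k(b′₋)² Kv₀(b,b′)Kv₁(b,b′)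
Σ_{a,c,a′,c′}(e_a·q²e_c)(e_{a′}·q²e_{c′}) Ks((b₋,a),(b′₋,a′)) Φ((b₋,c),(b′₋,c′))`); §9 `opCoeff_eq_apply`, **`sum_opCoeff_mul`**
(`Σ_c(e_a·Te_c)u_c = (Tu)_a`), **`inner_sq_sq`** (`q²u·q²v = u·q⁴v`), `pairExt5`, `pairExt5_apply`, **`fifth122T`**, **`graphAmp_g318a_extS`**,
**`graphAmp_g318a_free`** (`= (e²/2)²·d·Σ_{x,x′} η^{2d} g₀g₁ g_k²g_k′² C₀(x,x′)C(x,x′)² (q²φ(x)·q²φ′(x′))`), **`graphAmp_g318a_print`**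
(`= (1/8)·fifth122T`).  v1.1 (APPEND-ONLY, §§1–9 byte-identical): §10 ① = (3.6)₃ (`g36c`, FILE 3's `graphAmp_g36c_extS`): `pairExt1`,
`pairExt1_apply`, **`first122T`** (print's *"−4(N+2)λC^ε_0(0)δ^ε(x−x′)"* restated), **`graphAmp_g36c_free`** (`= −λ·N·Σ_{x∈Ω₁} w η^d C₀(x,x)
φ(x)·φ′(x)` — the φ′-loop gives the trace `N·C₀(x,x)`), **`graphAmp_g36c_print`** (`= (N/(4(N+2)))·first122T`: the drawn loop on ONE scalar
product is the N-type Wick term; print's `4(N+2) = 4N + 8`, a count consistent with the ordered choices of the two external legs — reading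
note); §11 ② = (3.6)₂ (`g36b`, FILE 3's `graphAmp_g36b_extS`): `pairExt2`, `pairExt2_apply`, **`second122T`** (print's *"e²dC^ε(0)q²δ^ε(x−x′)"*
restated, `q²` the operator), **`graphAmp_g36b_free`** (`= (e²/2)·d·Σ_x η^d g₀g_k² C(x,x) φ(x)·q²φ′(x)`), **`graphAmp_g36b_print`**
(`= (1/2)·second122T`).  With FILE 5's `graphAmp_g36a_free` (④ = (3.8): `−e²·graphTerm39T`, print's fourth term with `G_{(j)} ↦ C^ε_0`,
`G_{(j′)} ↦ C^ε`, `g = g′ = 1`) ALL SIX one- and two-vertex pictures ①–⑥ of (1.22) are evaluated against their displayed terms.  v1.2 (APPEND-ONLY + one import, FILE 5):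
§12 **`fourth122T`** (print's fourth term restated: FILE 5's four-term kernel `dKernelT`), **`graphAmp_g36a_print`** (`E(④) = fourth122T`, coefficient
one — FILE 5's `graphAmp_g36a_free` at `g₀ = g₁ = g_k = 1`).
HONEST SCOPE.  (a) These are evaluations of OUR evaluator on p18's drawings; print displays the analytic terms of (1.22) with their
combinatoric factors, and the comparison theorems `…_print` hold with the ratios of reading (d) — nothing is asserted about the derivation
of print's factors from Wick's theorem, about the «+ …», or about 1PI-ness.  (b) The free kernels, their internal-index / direction
structure, all bonds / `Ω₁ = T_ε`, `g_k = 1` and trivial weights are HYPOTHESES of the `free`/`print` theorems; §§2, 5, 8 hold in general.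
(c) The restated terms live on the (Higgs)₂,₃ carrier; `B3Eq123Counterterms.sig3/sig5/sig6` (the `Setup` carrier, scalar charge factor)
are not bridged here.  (d) Nothing analytic (no propagator property, no `ε → 0` statement — the divergence sentence of p. 416 is
`B3Eq122LocalDivergence`'s).  (e) ⑦ (`g122g`, three vertices with the (1.7) insertion) and the remaining (3.18) pictures `g318c–f`
((1.8) vertices, differentiated lines) are not evaluated here.  Unit `lit-balaban-p26` gen 42 (literature-prover-lit-balaban-p26-g42-0),
HOME `run/shared/lean/pub/lit-balaban/`, 2026-08-23 (v1.0 p369030; v1.1 p369633 and v1.2 append-only, same seat).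
-/

open Finset
open scoped BigOperators InnerProductSpace

namespace Literature.MathematicalPhysics.QuantumFieldTheory.Balaban1983to89.B3Eq122FromFeynmanRules

open Literature.MathematicalPhysics.QuantumFieldTheory.Balaban1983to89.B3Prop1 (VertexKind)
open Literature.MathematicalPhysics.QuantumFieldTheory.Balaban1983to89.B3Cor23Concrete (Graph)
open Literature.MathematicalPhysics.QuantumFieldTheory.Balaban1983to89.B3Sect3Graphs318 (g318a g318b g318g)
open Literature.MathematicalPhysics.QuantumFieldTheory.Balaban1983to89.B3GraphAmplitude
open Literature.MathematicalPhysics.QuantumFieldTheory.Balaban1983to89.B3GraphAmplitudeRules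
open Literature.MathematicalPhysics.QuantumFieldTheory.Balaban1983to89.B3Eq36TadpoleExpressions (basisE_eq opCoeff pleg110_basisE sum_opCoeff)

noncomputable section

variable {nbar : ℕ}

/-! ## §1 The picture ③ of (1.22) = (3.18)₂ (p18's `g318b`: one vertex (1.10)_{4,0}, A′-legs 0–3 and 1–2 joined, both φ′-legs external) -/

section Legs3

/-- The vertex of ③. [cite: Balaban1983Higgs3, (1.22) p.416] -/
def w3 (nbar : ℕ) (hn4 : 4 ≤ nbar) : Fin (g318b nbar hn4).nV := ⟨0, Nat.one_pos⟩

/-- The two φ′-legs of the (1.10)_{4,0} vertex of ③. [cite: Balaban1983Higgs3, (1.22) p.416] -/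
def sb3 (nbar : ℕ) (hn4 : 4 ≤ nbar) (j : Fin 2) : SLeg (g318b nbar hn4).kind := ⟨w3 nbar hn4, j⟩

/-- The four A′-legs of the (1.10)_{4,0} vertex of ③. [cite: Balaban1983Higgs3, (1.22) p.416] -/
def tb3 (nbar : ℕ) (hn4 : 4 ≤ nbar) (j : Fin 4) : VLeg (g318b nbar hn4).kind := ⟨w3 nbar hn4, j⟩

variable {hn4 : 4 ≤ nbar}

/-- both φ′-legs of ③ are external. [cite: Balaban1983Higgs3, (1.22) p.416] -/
theorem sother3_none : ∀ ℓ : SLeg (g318b nbar hn4).kind, (sPairing (g318b nbar hn4)).other ℓ = none := by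
  show ∀ ℓ : SLeg (g318b 4 le_rfl).kind, (sPairing (g318b 4 le_rfl)).other ℓ = none
  decide

/-- every φ′-leg of ③ is one of the two legs of its vertex. [cite: Balaban1983Higgs3, (1.22) p.416] -/
theorem sb3_cases : ∀ ℓ : SLeg (g318b nbar hn4).kind, ℓ = sb3 nbar hn4 0 ∨ ℓ = sb3 nbar hn4 1 := by
  show ∀ ℓ : SLeg (g318b 4 le_rfl).kind, ℓ = sb3 4 le_rfl 0 ∨ ℓ = sb3 4 le_rfl 1
  decide

/-- every A′-leg of ③ is one of the four legs of its vertex. [cite: Balaban1983Higgs3, (1.22) p.416] -/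
theorem tb3_cases : ∀ ℓ : VLeg (g318b nbar hn4).kind,
    ℓ = tb3 nbar hn4 0 ∨ ℓ = tb3 nbar hn4 1 ∨ ℓ = tb3 nbar hn4 2 ∨ ℓ = tb3 nbar hn4 3 := by
  show ∀ ℓ : VLeg (g318b 4 le_rfl).kind, ℓ = tb3 4 le_rfl 0 ∨ ℓ = tb3 4 le_rfl 1 ∨ ℓ = tb3 4 le_rfl 2 ∨ ℓ = tb3 4 le_rfl 3
  decide

/-- the two φ′-legs are distinct. [cite: Balaban1983Higgs3, (1.22) p.416] -/
theorem sb3_injective : Function.Injective (sb3 nbar hn4) := by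
  intro i j h
  simp only [sb3, Sigma.mk.inj_iff, heq_eq_eq, true_and] at h
  exact h

/-- the four A′-legs are distinct. [cite: Balaban1983Higgs3, (1.22) p.416] -/
theorem tb3_injective : Function.Injective (tb3 nbar hn4) := by
  intro i j h
  simp only [tb3, Sigma.mk.inj_iff, heq_eq_eq, true_and] at h
  exact h

/-- ③ has no φ′-line. [cite: Balaban1983Higgs3, (1.22) p.416] -/
instance instIsEmptySLine3 : IsEmpty (SLine (g318b nbar hn4)) :=
  ⟨fun l => by
    have h := l.2
    rw [(sPairing (g318b nbar hn4)).not_isLower_of_none sRank (sother3_none l.1)] at h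
    exact Bool.false_ne_true h⟩

/-- **The A′-lines of ③**: A′-leg `j` is joined to A′-leg `3 − j` (p18's `g318b.other`: the two tadpoles 0–3 and 1–2).
[cite: Balaban1983Higgs3, (1.22) p.416] -/
theorem vother3 (j : Fin 4) : (vPairing (g318b nbar hn4)).other (tb3 nbar hn4 j) = some (tb3 nbar hn4 j.rev) := by
  show vpartner (g318b nbar hn4) (tb3 nbar hn4 j) = some (tb3 nbar hn4 j.rev)
  exact (vpartner_eq_some_iff _ _ _).2 rfl

/-- A′-legs 0 and 1 are the lower endpoints of the two A′-lines of ③, and the only ones. [cite: Balaban1983Higgs3, (1.22) p.416] -/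
theorem vlower3_iff : ∀ ℓ : VLeg (g318b nbar hn4).kind,
    (vPairing (g318b nbar hn4)).isLower vRank ℓ = true ↔ ℓ = tb3 nbar hn4 0 ∨ ℓ = tb3 nbar hn4 1 := by
  show ∀ ℓ : VLeg (g318b 4 le_rfl).kind,
    (vPairing (g318b 4 le_rfl)).isLower vRank ℓ = true ↔ ℓ = tb3 4 le_rfl 0 ∨ ℓ = tb3 4 le_rfl 1
  decide

/-- no A′-leg of ③ is external. [cite: Balaban1983Higgs3, (1.22) p.416] -/
theorem vother3_ne_none : ∀ ℓ : VLeg (g318b nbar hn4).kind, (vPairing (g318b nbar hn4)).other ℓ ≠ none := by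
  intro ℓ
  rcases tb3_cases ℓ with h | h | h | h <;> rw [h, vother3] <;> exact Option.some_ne_none _

/-- The A′-line of ③ through the legs 0, 3 (the first tadpole). [cite: Balaban1983Higgs3, (1.22) p.416] -/
def vl3a (nbar : ℕ) (hn4 : 4 ≤ nbar) : VLine (g318b nbar hn4) := ⟨tb3 nbar hn4 0, (vlower3_iff _).2 (Or.inl rfl)⟩

/-- The A′-line of ③ through the legs 1, 2 (the second tadpole). [cite: Balaban1983Higgs3, (1.22) p.416] -/
def vl3b (nbar : ℕ) (hn4 : 4 ≤ nbar) : VLine (g318b nbar hn4) := ⟨tb3 nbar hn4 1, (vlower3_iff _).2 (Or.inr rfl)⟩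

/-- the two A′-lines are distinct. [cite: Balaban1983Higgs3, (1.22) p.416] -/
theorem vl3a_ne_vl3b : vl3a nbar hn4 ≠ vl3b nbar hn4 := fun h => absurd (tb3_injective (congrArg Subtype.val h)) (by decide)

/-- the A′-lines of ③ are exactly `vl3a`, `vl3b`. [cite: Balaban1983Higgs3, (1.22) p.416] -/
theorem univ_vline3 : (univ : Finset (VLine (g318b nbar hn4))) = {vl3a nbar hn4, vl3b nbar hn4} := by
  ext l
  simp only [Finset.mem_univ, Finset.mem_insert, Finset.mem_singleton, true_iff]
  rcases (vlower3_iff l.1).1 l.2 with h | h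
  · left; exact Subtype.ext h
  · right; exact Subtype.ext h

/-- the mates: leg 0 ↦ leg 3, leg 1 ↦ leg 2. [cite: Balaban1983Higgs3, (1.22) p.416] -/
theorem vmate3 : (vPairing (g318b nbar hn4)).mate (tb3 nbar hn4 0) = tb3 nbar hn4 3 ∧
    (vPairing (g318b nbar hn4)).mate (tb3 nbar hn4 1) = tb3 nbar hn4 2 :=
  ⟨(vPairing (g318b nbar hn4)).mate_eq (vother3 0), (vPairing (g318b nbar hn4)).mate_eq (vother3 1)⟩

/-- ③ has no external A′-leg. [cite: Balaban1983Higgs3, (1.22) p.416] -/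
instance instIsEmptyExtVLeg3 : IsEmpty (ExtVLeg (g318b nbar hn4)) := ⟨fun l => vother3_ne_none l.1 l.2⟩

/-- ③ has no averaging output. [cite: Balaban1983Higgs3, (1.22) p.416] -/
instance instIsEmptyOLeg3 : IsEmpty (OLeg (g318b nbar hn4).kind) := ⟨fun ℓ => Fin.elim0 (ℓ.2 : Fin 0)⟩

/-- The external φ′-legs of ③ (both legs). [cite: Balaban1983Higgs3, (1.22) p.416] -/
def es3 (nbar : ℕ) (hn4 : 4 ≤ nbar) (j : Fin 2) : ExtSLeg (g318b nbar hn4) := ⟨sb3 nbar hn4 j, sother3_none _⟩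

/-- `es3 0 ≠ es3 1`. [cite: Balaban1983Higgs3, (1.22) p.416] -/
theorem es3_0_ne_1 : es3 nbar hn4 0 ≠ es3 nbar hn4 1 := fun h => absurd (sb3_injective (congrArg Subtype.val h)) (by decide)

/-- the external φ′-legs of ③ are exactly `es3 0`, `es3 1`. [cite: Balaban1983Higgs3, (1.22) p.416] -/
theorem univ_extSLeg3 : (univ : Finset (ExtSLeg (g318b nbar hn4))) = {es3 nbar hn4 0, es3 nbar hn4 1} := by
  ext l
  simp only [Finset.mem_univ, Finset.mem_insert, Finset.mem_singleton, true_iff]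
  rcases sb3_cases l.1 with h | h
  · left; exact Subtype.ext h
  · right; exact Subtype.ext h

end Legs3

/-! ## §2 ③ evaluated: `E = (e⁴η²/4!) Σ_{b∈S} w(b) η^d g_k(b₋)⁴ Kv₀(b,b) Kv₁(b,b) Σ_{a,a′}(e_a·q⁴e_{a′}) Φ((b₋,a),(b₋,a′))` -/

section Eval3

variable {P : HiggsLattice.Params} {N k : ℕ} {hn4 : 4 ≤ nbar}

/-- The index assignment of ③ with the φ′-legs 0, 1 at `(x, a)`, `(x, a′)`. [cite: Balaban1983Higgs3, (1.22) p.416] -/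
def assign3 (x : HiggsLattice.Site P 0) (aa : Fin N × Fin N) : SLeg (g318b nbar hn4).kind → HiggsLattice.Site P 0 × Fin N :=
  fun ℓ => if ℓ = sb3 nbar hn4 0 then (x, aa.1) else (x, aa.2)

/-- `assign3` on leg 0: `(x, a)`. [cite: Balaban1983Higgs3, (1.22) p.416] -/
theorem assign3_sb0 (x : HiggsLattice.Site P 0) (aa : Fin N × Fin N) :
    assign3 (hn4 := hn4) x aa (sb3 nbar hn4 0) = (x, aa.1) := by
  simp [assign3]

/-- `assign3` on leg 1: `(x, a′)`. [cite: Balaban1983Higgs3, (1.22) p.416] -/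
theorem assign3_sb1 (x : HiggsLattice.Site P 0) (aa : Fin N × Fin N) :
    assign3 (hn4 := hn4) x aa (sb3 nbar hn4 1) = (x, aa.2) := by
  have h : sb3 nbar hn4 1 ≠ sb3 nbar hn4 0 := fun h => absurd (sb3_injective h) (by decide)
  simp [assign3, h]

/-- `assign3 x` is injective. [cite: Balaban1983Higgs3, (1.22) p.416] -/
theorem assign3_injective (x : HiggsLattice.Site P 0) : Function.Injective (assign3 (hn4 := hn4) (N := N) x) := by
  rintro ⟨a, a'⟩ ⟨c, c'⟩ h
  have h0 := congrFun h (sb3 nbar hn4 0)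
  have h1 := congrFun h (sb3 nbar hn4 1)
  rw [assign3_sb0, assign3_sb0] at h0
  rw [assign3_sb1, assign3_sb1] at h1
  simp only [Prod.mk.injEq, true_and] at h0 h1
  rw [h0, h1]

/-- The external legs of ③ at `(x, a)`, `(x, a′)`. [cite: Balaban1983Higgs3, (1.22) p.416] -/
def extAt3 (x : HiggsLattice.Site P 0) (aa : Fin N × Fin N) : ExtSLeg (g318b nbar hn4) → HiggsLattice.Site P 0 × Fin N :=
  fun ℓ => assign3 x aa ℓ.1

/-- kernel: the Kronecker sum over the φ′-leg assignments of ③ — both legs at the site `x`, free internal indices. [folklore] -/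
private theorem sdelta_sum3 (x : HiggsLattice.Site P 0) (F : (SLeg (g318b nbar hn4).kind → HiggsLattice.Site P 0 × Fin N) → ℝ) :
    ∑ α : SLeg (g318b nbar hn4).kind → HiggsLattice.Site P 0 × Fin N,
        (if x = (α (sb3 nbar hn4 0)).1 ∧ x = (α (sb3 nbar hn4 1)).1 then (1 : ℝ) else 0) * F α =
      ∑ a : Fin N, ∑ a' : Fin N, F (assign3 x (a, a')) := by
  classical
  set S : Finset (SLeg (g318b nbar hn4).kind → HiggsLattice.Site P 0 × Fin N) := univ.image (assign3 x) with hS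
  rw [← Finset.sum_subset (Finset.subset_univ S)]
  · rw [hS, Finset.sum_image fun ab _ ab' _ h => assign3_injective x h]
    have hterm : ∀ aa : Fin N × Fin N,
        (if x = (assign3 (hn4 := hn4) x aa (sb3 nbar hn4 0)).1 ∧ x = (assign3 (hn4 := hn4) x aa (sb3 nbar hn4 1)).1
          then (1 : ℝ) else 0) * F (assign3 x aa) = F (assign3 x aa) := by
      intro aa
      rw [assign3_sb0, assign3_sb1]
      simp
    simp only [hterm]
    rw [Fintype.sum_prod_type]
  · intro α _ hα
    by_cases h01 : x = (α (sb3 nbar hn4 0)).1 ∧ x = (α (sb3 nbar hn4 1)).1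
    · exfalso
      apply hα
      rw [hS, Finset.mem_image]
      refine ⟨((α (sb3 nbar hn4 0)).2, (α (sb3 nbar hn4 1)).2), Finset.mem_univ _, ?_⟩
      funext ℓ
      rcases sb3_cases ℓ with h | h <;> subst h
      · rw [assign3_sb0]; exact Prod.ext h01.1 rfl
      · rw [assign3_sb1]; exact Prod.ext h01.2 rfl
    · rw [if_neg h01, zero_mul]

/-- A PRODUCT external field of ③ at the contributing assignments. [cite: Balaban1983Higgs3, p.419] -/
theorem extS_extAt3 (φ : ExtSLeg (g318b nbar hn4) → HiggsLattice.ScalarField P 0 N) (x : HiggsLattice.Site P 0) (aa : Fin N × Fin N) :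
    extS (g318b nbar hn4) φ (extAt3 x aa) = φ (es3 nbar hn4 0) x aa.1 * φ (es3 nbar hn4 1) x aa.2 := by
  unfold extS
  rw [show (∏ ℓ : ExtSLeg (g318b nbar hn4), φ ℓ (extAt3 x aa ℓ).1 (extAt3 x aa ℓ).2) =
      ∏ ℓ ∈ ({es3 nbar hn4 0, es3 nbar hn4 1} : Finset _), φ ℓ (extAt3 x aa ℓ).1 (extAt3 x aa ℓ).2 by rw [← univ_extSLeg3],
    Finset.prod_pair es3_0_ne_1]
  show φ (es3 nbar hn4 0) (assign3 (hn4 := hn4) x aa (sb3 nbar hn4 0)).1 (assign3 (hn4 := hn4) x aa (sb3 nbar hn4 0)).2 *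
      φ (es3 nbar hn4 1) (assign3 (hn4 := hn4) x aa (sb3 nbar hn4 1)).1 (assign3 (hn4 := hn4) x aa (sb3 nbar hn4 1)).2 = _
  rw [assign3_sb0, assign3_sb1]

variable [DecidableEq (HiggsLattice.PBond P 0)]

/-- The polarized A′-legs of (1.10)_{4,0} on basis bond fields: `Π_{j<4} g(b₋)δ_{β_j}(b) = [b = β_j ∀ j]·g(b₋)⁴`.
[cite: Balaban1983Higgs3, (1.10) p.413] -/
theorem vlegs_basisV_four (g : HiggsLattice.Site P 0 → ℝ)
    (β : VLeg (g318b nbar hn4).kind → HiggsLattice.PBond P 0) (b : HiggsLattice.PBond P 0) :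
    vlegs g (fun j => basisV (β (tb3 nbar hn4 j))) b =
      (if ∀ j : Fin 4, b = β (tb3 nbar hn4 j) then (1 : ℝ) else 0) * g b.src ^ 4 := by
  by_cases h : ∀ j : Fin 4, b = β (tb3 nbar hn4 j)
  · rw [if_pos h, one_mul]
    unfold vlegs
    have h1 : ∀ j : Fin 4, g b.src * basisV (β (tb3 nbar hn4 j)) b = g b.src := fun j => by
      have e : basisV (β (tb3 nbar hn4 j)) b = 1 := by simp only [basisV]; rw [if_pos (h j)]
      rw [e, mul_one]
    simp only [h1, Finset.prod_const, Finset.card_univ, Fintype.card_fin]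
  · rw [if_neg h, zero_mul]
    obtain ⟨j, hj⟩ := not_forall.mp h
    unfold vlegs
    have e : basisV (β (tb3 nbar hn4 j)) b = 0 := by simp only [basisV]; rw [if_neg hj]
    exact Finset.prod_eq_zero (Finset.mem_univ j) (by show g b.src * basisV (β (tb3 nbar hn4 j)) b = 0; rw [e, mul_zero])

/-- kernel: the Kronecker sum over the A′-leg assignments of ③ — all four legs at the bond `b`. [folklore] -/
private theorem vdelta_sum3 (b : HiggsLattice.PBond P 0) (F : (VLeg (g318b nbar hn4).kind → HiggsLattice.PBond P 0) → ℝ) :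
    ∑ β : VLeg (g318b nbar hn4).kind → HiggsLattice.PBond P 0,
        (if ∀ j : Fin 4, b = β (tb3 nbar hn4 j) then (1 : ℝ) else 0) * F β = F (fun _ => b) := by
  classical
  rw [Finset.sum_eq_single (fun _ => b)]
  · simp
  · intro β _ hβ
    have : ¬(∀ j : Fin 4, b = β (tb3 nbar hn4 j)) := by
      intro h
      apply hβ
      funext ℓ
      rcases tb3_cases ℓ with e | e | e | e <;> rw [e] <;> exact (h _).symm
    rw [if_neg this, zero_mul]
  · intro h
    exact absurd (Finset.mem_univ _) h

/-- **The evaluator EVALUATED on the picture ③ of (1.22) (= (3.18)₂: one vertex (1.10)_{4,0} carrying two A′-tadpoles)**: for the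
model data `M`, the localization weight `w = (loc v).wB`, any vector line kernels `Kv` (one per tadpole) and any joint external scalar
field `Φ`, the expression of p18's graph `g318b` is
`E = (e⁴η²/4!) Σ_{b∈S} w(b) η^d g_k(b₋)⁴ · Kv₀(b,b) · Kv₁(b,b) · Σ_{a,a′} (e_a·q⁴e_{a′}) Φ((b₋,a),(b₋,a′))` — the vertex (1.10)_{4,0}
(`e⁴η^{4−2}/4!`, p. 413) with each joined pair of A′-legs replaced by the DIAGONAL of its line's covariance at the vertex's bond
(*"each pair is replaced by the corresponding propagator"*, p. 414), the two external φ′-legs at `b₋` contracted into `q⁴`.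
[cite: Balaban1983Higgs3, (1.22) p.416] [cite: Balaban1983Higgs3, (3.18) p.438] -/
theorem graphAmp_g318b (M : Model P N k) (dm2 : Fin (g318b nbar hn4).nV → HiggsLattice.Site P 0 → ℝ)
    (loc : Fin (g318b nbar hn4).nV → Loc P k) (Po : OutPairing (g318b nbar hn4))
    (Ks : SLine (g318b nbar hn4) → HiggsLattice.Site P 0 × Fin N → HiggsLattice.Site P 0 × Fin N → ℝ)
    (Kv : VLine (g318b nbar hn4) → HiggsLattice.PBond P 0 → HiggsLattice.PBond P 0 → ℝ)
    (Ko : Po.Line oRank → HiggsLattice.Site P k × Fin N → HiggsLattice.Site P k × Fin N → ℝ)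
    (Φ : (ExtSLeg (g318b nbar hn4) → HiggsLattice.Site P 0 × Fin N) → ℝ) :
    graphAmp (g318b nbar hn4) M dm2 loc Po Ks Kv Ko Φ (fun _ => 1) (fun _ => 1) =
      M.C.e ^ 4 * P.mesh 0 ^ 2 / 24 * ∑ b ∈ M.S, (loc (w3 nbar hn4)).wB b * (P.mesh 0 ^ P.d * M.g b.src ^ 4 *
        (Kv (vl3a nbar hn4) b b * Kv (vl3b nbar hn4) b b) *
          ∑ a : Fin N, ∑ a' : Fin N, opCoeff (M.C.q ^ 4) a a' * Φ (extAt3 b.src (a, a'))) := by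
  haveI : IsEmpty (Po.Line oRank) := ⟨fun l => IsEmpty.false l.1⟩
  have hV : ∀ (α : SLeg (g318b nbar hn4).kind → HiggsLattice.Site P 0 × Fin N)
      (β : VLeg (g318b nbar hn4).kind → HiggsLattice.PBond P 0) (ο : OLeg (g318b nbar hn4).kind → HiggsLattice.Site P k × Fin N),
      vertexFactor (rulesOf (g318b nbar hn4) M dm2 loc) basisE basisV basisE α β ο =
        rule110 M.C M.g M.At 4 0 M.S (loc (w3 nbar hn4)).wB (fun j => basisE (α (sb3 nbar hn4 j)))
          (fun j => basisV (β (tb3 nbar hn4 j))) := by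
    intro α β ο
    unfold vertexFactor
    exact Fin.prod_univ_one _
  have hs : ∀ α : SLeg (g318b nbar hn4).kind → HiggsLattice.Site P 0 × Fin N, sLineFactor Ks α = 1 := by
    intro α
    unfold sLineFactor
    exact Fintype.prod_empty _
  have hv : ∀ β : VLeg (g318b nbar hn4).kind → HiggsLattice.PBond P 0,
      vLineFactor Kv β = Kv (vl3a nbar hn4) (β (tb3 nbar hn4 0)) (β (tb3 nbar hn4 3)) *
        Kv (vl3b nbar hn4) (β (tb3 nbar hn4 1)) (β (tb3 nbar hn4 2)) := by
    intro β
    unfold vLineFactor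
    rw [show (∏ l : VLine (g318b nbar hn4), Kv l (β l.1) (β ((vPairing (g318b nbar hn4)).mate l.1))) =
        ∏ l ∈ ({vl3a nbar hn4, vl3b nbar hn4} : Finset _), Kv l (β l.1) (β ((vPairing (g318b nbar hn4)).mate l.1)) by
          rw [← univ_vline3], Finset.prod_pair vl3a_ne_vl3b]
    show Kv (vl3a nbar hn4) (β (tb3 nbar hn4 0)) (β ((vPairing (g318b nbar hn4)).mate (tb3 nbar hn4 0))) *
        Kv (vl3b nbar hn4) (β (tb3 nbar hn4 1)) (β ((vPairing (g318b nbar hn4)).mate (tb3 nbar hn4 1))) = _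
    rw [vmate3.1, vmate3.2]
  have ho : ∀ ο : OLeg (g318b nbar hn4).kind → HiggsLattice.Site P k × Fin N, oLineFactor Po Ko ο = 1 := by
    intro ο
    unfold oLineFactor
    exact Fintype.prod_empty _
  -- the (1.10)_{4,0} rule on basis fields
  have hrule : ∀ (α : SLeg (g318b nbar hn4).kind → HiggsLattice.Site P 0 × Fin N)
      (β : VLeg (g318b nbar hn4).kind → HiggsLattice.PBond P 0),
      rule110 M.C M.g M.At 4 0 M.S (loc (w3 nbar hn4)).wB (fun j => basisE (α (sb3 nbar hn4 j)))
          (fun j => basisV (β (tb3 nbar hn4 j))) =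
        ∑ b ∈ M.S, (M.C.e ^ 4 * P.mesh 0 ^ 2 / 24 * ((loc (w3 nbar hn4)).wB b * P.mesh 0 ^ P.d)) *
          (((if b.src = (α (sb3 nbar hn4 0)).1 ∧ b.src = (α (sb3 nbar hn4 1)).1 then (1 : ℝ) else 0) *
              opCoeff (M.C.q ^ 4) (α (sb3 nbar hn4 0)).2 (α (sb3 nbar hn4 1)).2) *
            ((if ∀ j : Fin 4, b = β (tb3 nbar hn4 j) then (1 : ℝ) else 0) * M.g b.src ^ 4)) := by
    intro α β
    unfold rule110
    simp only [pleg110_basisE, vlegs_basisV_four, pow_zero, mul_one, add_zero]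
    rw [Finset.mul_sum]
    refine Finset.sum_congr rfl fun b _ => ?_
    have h24 : ((Nat.factorial 4 : ℕ) : ℝ) = 24 := by norm_num [Nat.factorial]
    have h0 : ((Nat.factorial 0 : ℕ) : ℝ) = 1 := by norm_num [Nat.factorial]
    have hz : P.mesh 0 ^ (((4 : ℕ) : ℤ) + ((0 : ℕ) : ℤ) - 2) = P.mesh 0 ^ (2 : ℕ) := by
      rw [show (((4 : ℕ) : ℤ) + ((0 : ℕ) : ℤ) - 2) = ((2 : ℕ) : ℤ) by norm_num, zpow_natCast]
    rw [h24, h0, hz]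
    ring
  unfold graphAmp amp
  simp only [Fintype.sum_unique, hV, hs, hv, ho, mul_one, one_mul, hrule]
  -- rearrange: the bond sum outermost
  have h1 : ∀ (α : SLeg (g318b nbar hn4).kind → HiggsLattice.Site P 0 × Fin N)
      (β : VLeg (g318b nbar hn4).kind → HiggsLattice.PBond P 0),
      (∑ b ∈ M.S, (M.C.e ^ 4 * P.mesh 0 ^ 2 / 24 * ((loc (w3 nbar hn4)).wB b * P.mesh 0 ^ P.d)) *
          (((if b.src = (α (sb3 nbar hn4 0)).1 ∧ b.src = (α (sb3 nbar hn4 1)).1 then (1 : ℝ) else 0) *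
              opCoeff (M.C.q ^ 4) (α (sb3 nbar hn4 0)).2 (α (sb3 nbar hn4 1)).2) *
            ((if ∀ j : Fin 4, b = β (tb3 nbar hn4 j) then (1 : ℝ) else 0) * M.g b.src ^ 4))) *
          Φ (fun ℓ => α ℓ.1) *
          (Kv (vl3a nbar hn4) (β (tb3 nbar hn4 0)) (β (tb3 nbar hn4 3)) * Kv (vl3b nbar hn4) (β (tb3 nbar hn4 1)) (β (tb3 nbar hn4 2))) =
        ∑ b ∈ M.S, (M.C.e ^ 4 * P.mesh 0 ^ 2 / 24 * ((loc (w3 nbar hn4)).wB b * P.mesh 0 ^ P.d)) *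
          (((if b.src = (α (sb3 nbar hn4 0)).1 ∧ b.src = (α (sb3 nbar hn4 1)).1 then (1 : ℝ) else 0) *
              (opCoeff (M.C.q ^ 4) (α (sb3 nbar hn4 0)).2 (α (sb3 nbar hn4 1)).2 * Φ (fun ℓ => α ℓ.1))) *
            ((if ∀ j : Fin 4, b = β (tb3 nbar hn4 j) then (1 : ℝ) else 0) *
              (M.g b.src ^ 4 * (Kv (vl3a nbar hn4) (β (tb3 nbar hn4 0)) (β (tb3 nbar hn4 3)) *
                Kv (vl3b nbar hn4) (β (tb3 nbar hn4 1)) (β (tb3 nbar hn4 2)))))) := by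
    intro α β
    rw [Finset.sum_mul, Finset.sum_mul]
    exact Finset.sum_congr rfl fun b _ => by ring
  rw [Finset.sum_congr rfl fun α _ => Finset.sum_congr rfl fun β _ => h1 α β]
  have h2 : ∀ α : SLeg (g318b nbar hn4).kind → HiggsLattice.Site P 0 × Fin N,
      ∑ β : VLeg (g318b nbar hn4).kind → HiggsLattice.PBond P 0, ∑ b ∈ M.S,
          (M.C.e ^ 4 * P.mesh 0 ^ 2 / 24 * ((loc (w3 nbar hn4)).wB b * P.mesh 0 ^ P.d)) *
            (((if b.src = (α (sb3 nbar hn4 0)).1 ∧ b.src = (α (sb3 nbar hn4 1)).1 then (1 : ℝ) else 0) *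
                (opCoeff (M.C.q ^ 4) (α (sb3 nbar hn4 0)).2 (α (sb3 nbar hn4 1)).2 * Φ (fun ℓ => α ℓ.1))) *
              ((if ∀ j : Fin 4, b = β (tb3 nbar hn4 j) then (1 : ℝ) else 0) *
                (M.g b.src ^ 4 * (Kv (vl3a nbar hn4) (β (tb3 nbar hn4 0)) (β (tb3 nbar hn4 3)) *
                  Kv (vl3b nbar hn4) (β (tb3 nbar hn4 1)) (β (tb3 nbar hn4 2)))))) =
        ∑ b ∈ M.S, (M.C.e ^ 4 * P.mesh 0 ^ 2 / 24 * ((loc (w3 nbar hn4)).wB b * P.mesh 0 ^ P.d)) *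
            (((if b.src = (α (sb3 nbar hn4 0)).1 ∧ b.src = (α (sb3 nbar hn4 1)).1 then (1 : ℝ) else 0) *
                (opCoeff (M.C.q ^ 4) (α (sb3 nbar hn4 0)).2 (α (sb3 nbar hn4 1)).2 * Φ (fun ℓ => α ℓ.1))) *
              (M.g b.src ^ 4 * (Kv (vl3a nbar hn4) b b * Kv (vl3b nbar hn4) b b))) := by
    intro α
    rw [Finset.sum_comm]
    refine Finset.sum_congr rfl fun b _ => ?_
    rw [← Finset.mul_sum, ← Finset.mul_sum]
    rw [vdelta_sum3 b fun β => M.g b.src ^ 4 * (Kv (vl3a nbar hn4) (β (tb3 nbar hn4 0)) (β (tb3 nbar hn4 3)) *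
      Kv (vl3b nbar hn4) (β (tb3 nbar hn4 1)) (β (tb3 nbar hn4 2)))]
  rw [Finset.sum_congr rfl fun α _ => h2 α, Finset.sum_comm, Finset.mul_sum]
  refine Finset.sum_congr rfl fun b _ => ?_
  have h3 : ∀ α : SLeg (g318b nbar hn4).kind → HiggsLattice.Site P 0 × Fin N,
      (M.C.e ^ 4 * P.mesh 0 ^ 2 / 24 * ((loc (w3 nbar hn4)).wB b * P.mesh 0 ^ P.d)) *
          (((if b.src = (α (sb3 nbar hn4 0)).1 ∧ b.src = (α (sb3 nbar hn4 1)).1 then (1 : ℝ) else 0) *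
              (opCoeff (M.C.q ^ 4) (α (sb3 nbar hn4 0)).2 (α (sb3 nbar hn4 1)).2 * Φ (fun ℓ => α ℓ.1))) *
            (M.g b.src ^ 4 * (Kv (vl3a nbar hn4) b b * Kv (vl3b nbar hn4) b b))) =
        (M.C.e ^ 4 * P.mesh 0 ^ 2 / 24 * ((loc (w3 nbar hn4)).wB b * P.mesh 0 ^ P.d) *
            (M.g b.src ^ 4 * (Kv (vl3a nbar hn4) b b * Kv (vl3b nbar hn4) b b))) *
          ((if b.src = (α (sb3 nbar hn4 0)).1 ∧ b.src = (α (sb3 nbar hn4 1)).1 then (1 : ℝ) else 0) *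
            (opCoeff (M.C.q ^ 4) (α (sb3 nbar hn4 0)).2 (α (sb3 nbar hn4 1)).2 * Φ (fun ℓ => α ℓ.1))) := by
    intro α
    ring
  rw [Finset.sum_congr rfl fun α _ => h3 α, ← Finset.mul_sum,
    sdelta_sum3 b.src fun α => opCoeff (M.C.q ^ 4) (α (sb3 nbar hn4 0)).2 (α (sb3 nbar hn4 1)).2 * Φ (fun ℓ => α ℓ.1)]
  simp only [assign3_sb0, assign3_sb1]
  unfold extAt3
  ring

/-- **③ for product external fields**: `E = (e⁴η²/4!) Σ_{b∈S} w(b) η^d g_k(b₋)⁴ Kv₀(b,b) Kv₁(b,b) [φ₀(b₋)·q⁴φ₁(b₋)]` — the vertex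
(1.10)_{4,0} with `(g_kA′_b)⁴` REPLACED BY `g_k(b₋)⁴·Kv₀(b,b)Kv₁(b,b)` (the two tadpoles). [cite: Balaban1983Higgs3, (1.22) p.416]
[cite: Balaban1983Higgs3, (3.18) p.438] -/
theorem graphAmp_g318b_extS (M : Model P N k) (dm2 : Fin (g318b nbar hn4).nV → HiggsLattice.Site P 0 → ℝ)
    (loc : Fin (g318b nbar hn4).nV → Loc P k) (Po : OutPairing (g318b nbar hn4))
    (Ks : SLine (g318b nbar hn4) → HiggsLattice.Site P 0 × Fin N → HiggsLattice.Site P 0 × Fin N → ℝ)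
    (Kv : VLine (g318b nbar hn4) → HiggsLattice.PBond P 0 → HiggsLattice.PBond P 0 → ℝ)
    (Ko : Po.Line oRank → HiggsLattice.Site P k × Fin N → HiggsLattice.Site P k × Fin N → ℝ)
    (φ : ExtSLeg (g318b nbar hn4) → HiggsLattice.ScalarField P 0 N) :
    graphAmp (g318b nbar hn4) M dm2 loc Po Ks Kv Ko (extS (g318b nbar hn4) φ) (fun _ => 1) (fun _ => 1) =
      M.C.e ^ 4 * P.mesh 0 ^ 2 / 24 * ∑ b ∈ M.S, (loc (w3 nbar hn4)).wB b * (P.mesh 0 ^ P.d * M.g b.src ^ 4 *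
        (Kv (vl3a nbar hn4) b b * Kv (vl3b nbar hn4) b b) *
          ⟪φ (es3 nbar hn4 0) b.src, (M.C.q ^ 4) (φ (es3 nbar hn4 1) b.src)⟫_ℝ) := by
  rw [graphAmp_g318b]
  simp only [extS_extAt3, sum_opCoeff]

end Eval3

/-! ## §3 ③ at print's data of p. 416 (`B̃ = 0`, `g_k = 1`, all bonds, free kernels): the third term of (1.22) -/

section Free3

variable {P : HiggsLattice.Params} {N k : ℕ} {hn4 : 4 ≤ nbar}

/-- kernel: a sum over the positively oriented bonds is the sum over initial points and directions. [folklore] -/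
private theorem sum_bond {j : ℕ} (F : HiggsLattice.PBond P j → ℝ) :
    ∑ b, F b = ∑ x : HiggsLattice.Site P j, ∑ μ : Fin P.d, F ⟨x, μ⟩ := by
  let e : HiggsLattice.Site P j × Fin P.d ≃ HiggsLattice.PBond P j :=
    ⟨fun p => ⟨p.1, p.2⟩, fun b => (b.src, b.dir), fun _ => rfl, fun _ => rfl⟩
  rw [← Fintype.sum_equiv e (fun p => F ⟨p.1, p.2⟩) F fun _ => rfl, Fintype.sum_prod_type]

/-- The two external fields of ③: `φ` on the leg 0, `φ′` on the leg 1. [cite: Balaban1983Higgs3, (1.22) p.416] -/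
def pairExt3 (φ φ' : HiggsLattice.ScalarField P 0 N) : ExtSLeg (g318b nbar hn4) → HiggsLattice.ScalarField P 0 N :=
  fun ℓ => if ℓ = es3 nbar hn4 0 then φ else φ'

/-- `pairExt3` on the two legs. [cite: Balaban1983Higgs3, (1.22) p.416] -/
theorem pairExt3_apply (φ φ' : HiggsLattice.ScalarField P 0 N) :
    pairExt3 (hn4 := hn4) φ φ' (es3 nbar hn4 0) = φ ∧ pairExt3 (hn4 := hn4) φ φ' (es3 nbar hn4 1) = φ' :=
  ⟨if_pos rfl, if_neg (Ne.symm es3_0_ne_1)⟩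

/-- **THE THIRD TERM OF (1.22) as a bilinear form in the external fields**, on the (Higgs)₂,₃ torus carrier: print's
*"(2·3/4!) d e⁴ ε² (C^ε(0))² q⁴ δ^ε(x − x′)"* (p. 416) inserted between `φ(x)` and `φ′(x′)` and summed `Σ_{x,x′} ε^{2d}` — the lattice
δ collapses the `x′`-sum (as in `B3Eq123Counterterms.ct3_eq`): `(2·3/4!)·d·e⁴·ε² Σ_x ε^d C(x,x)² φ(x)·q⁴φ′(x)`, with `q⁴` the operator
(print's T1 convention writes the charge matrices as one factor) and `C(x,x)` the diagonal of the supplied vector propagator (print's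
`C^ε(0)`) — `B3Eq123Counterterms.sig3` RESTATED symbol by symbol on this carrier. [cite: Balaban1983Higgs3, (1.22) p.416] -/
def third122T (ε e : ℝ) (q : HiggsCovariance.E N →L[ℝ] HiggsCovariance.E N) (C : HiggsLattice.Site P 0 → HiggsLattice.Site P 0 → ℝ)
    (φ φ' : HiggsLattice.ScalarField P 0 N) : ℝ :=
  2 * 3 / 24 * (P.d : ℝ) * e ^ 4 * ε ^ 2 * ∑ x : HiggsLattice.Site P 0, ε ^ P.d * (C x x ^ 2 * ⟪φ x, (q ^ 4) (φ' x)⟫_ℝ)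

variable [DecidableEq (HiggsLattice.PBond P 0)]

/-- **③ with the free vector propagator**: summing over all bonds, with a site-valued localization weight `g₀` and the vector line
kernel `δ_{μμ′}C(b₋, b′₋)` on both tadpoles (diagonal in the bond directions — the READING of print's scalar kernel `C^ε` for the
A-lines, a hypothesis on the supplied kernels), the direction sum gives the factor `d` of print's third term:
`E = (e⁴η²/4!)·d·Σ_x η^d g₀(x) g_k(x)⁴ C(x,x)² φ(x)·q⁴φ′(x)`. [cite: Balaban1983Higgs3, (1.22) p.416] -/
theorem graphAmp_g318b_free (M : Model P N k) (hS : M.S = Finset.univ)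
    (dm2 : Fin (g318b nbar hn4).nV → HiggsLattice.Site P 0 → ℝ) (loc : Fin (g318b nbar hn4).nV → Loc P k)
    (g₀ : HiggsLattice.Site P 0 → ℝ) (hw : ∀ b, (loc (w3 nbar hn4)).wB b = g₀ b.src) (Po : OutPairing (g318b nbar hn4))
    (Ks : SLine (g318b nbar hn4) → HiggsLattice.Site P 0 × Fin N → HiggsLattice.Site P 0 × Fin N → ℝ)
    (Kv : VLine (g318b nbar hn4) → HiggsLattice.PBond P 0 → HiggsLattice.PBond P 0 → ℝ)
    (Ko : Po.Line oRank → HiggsLattice.Site P k × Fin N → HiggsLattice.Site P k × Fin N → ℝ)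
    (C : HiggsLattice.Site P 0 → HiggsLattice.Site P 0 → ℝ)
    (hKv : ∀ l b b', Kv l b b' = if b.dir = b'.dir then C b.src b'.src else 0) (φ φ' : HiggsLattice.ScalarField P 0 N) :
    graphAmp (g318b nbar hn4) M dm2 loc Po Ks Kv Ko (extS (g318b nbar hn4) (pairExt3 φ φ')) (fun _ => 1) (fun _ => 1) =
      M.C.e ^ 4 * P.mesh 0 ^ 2 / 24 * ((P.d : ℝ) * ∑ x : HiggsLattice.Site P 0,
        P.mesh 0 ^ P.d * (g₀ x * M.g x ^ 4 * C x x ^ 2 * ⟪φ x, (M.C.q ^ 4) (φ' x)⟫_ℝ)) := by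
  rw [graphAmp_g318b_extS]
  obtain ⟨e0, e1⟩ := pairExt3_apply (hn4 := hn4) φ φ'
  simp only [e0, e1, hw, hKv, hS, if_true]
  rw [sum_bond]
  congr 1
  have h1 : ∀ x : HiggsLattice.Site P 0, ∑ μ : Fin P.d,
      g₀ x * (P.mesh 0 ^ P.d * M.g x ^ 4 * (C x x * C x x) * ⟪φ x, (M.C.q ^ 4) (φ' x)⟫_ℝ) =
        (P.d : ℝ) * (P.mesh 0 ^ P.d * (g₀ x * M.g x ^ 4 * C x x ^ 2 * ⟪φ x, (M.C.q ^ 4) (φ' x)⟫_ℝ)) := by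
    intro x
    rw [Finset.sum_const, Finset.card_univ, Fintype.card_fin, nsmul_eq_mul]
    ring
  simp only [h1, ← Finset.mul_sum]

/-- **E(③) IS ONE SIXTH OF THE THIRD TERM OF (1.22)** at print's data of p. 416 (*"B̃ = 0, g_k = 1"*, all bonds of `T_ε`, trivial
localization, `η = ε`): `E = (1/6)·third122T` — the drawn labelled picture is ONE Wick term, print's coefficient `2·3/4!` counts the
`3` pairings of the four A-legs into two tadpoles and the `2` assignments of the external legs (p. 416: *"we did not write … combinatoric
factors before the graphs, understanding that they are a part of the graphical description"*); `q⁴` as the operator.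
[cite: Balaban1983Higgs3, (1.22) p.416] -/
theorem graphAmp_g318b_print (M : Model P N k) (hS : M.S = Finset.univ) (hg : M.g = fun _ => 1)
    (dm2 : Fin (g318b nbar hn4).nV → HiggsLattice.Site P 0 → ℝ) (loc : Fin (g318b nbar hn4).nV → Loc P k)
    (hw : ∀ b, (loc (w3 nbar hn4)).wB b = 1) (Po : OutPairing (g318b nbar hn4))
    (Ks : SLine (g318b nbar hn4) → HiggsLattice.Site P 0 × Fin N → HiggsLattice.Site P 0 × Fin N → ℝ)
    (Kv : VLine (g318b nbar hn4) → HiggsLattice.PBond P 0 → HiggsLattice.PBond P 0 → ℝ)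
    (Ko : Po.Line oRank → HiggsLattice.Site P k × Fin N → HiggsLattice.Site P k × Fin N → ℝ)
    (C : HiggsLattice.Site P 0 → HiggsLattice.Site P 0 → ℝ)
    (hKv : ∀ l b b', Kv l b b' = if b.dir = b'.dir then C b.src b'.src else 0) (φ φ' : HiggsLattice.ScalarField P 0 N) :
    graphAmp (g318b nbar hn4) M dm2 loc Po Ks Kv Ko (extS (g318b nbar hn4) (pairExt3 φ φ')) (fun _ => 1) (fun _ => 1) =
      1 / 6 * third122T (P.mesh 0) M.C.e M.C.q C φ φ' := by
  rw [graphAmp_g318b_free M hS dm2 loc (fun _ => 1) (fun b => hw b) Po Ks Kv Ko C hKv φ φ', third122T, hg]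
  simp only [one_pow, one_mul, mul_one]
  ring

end Free3

/-! ## §4 The picture ⑥ of (1.22) = (3.18)₇ (p18's `g318g`: two vertices (1.6) joined by three φ′-lines, the fourth leg of each external) -/

section Legs6

/-- The φ′-leg `j` of the vertex `i` of ⑥ (p18's `g318g`: the legs `j < 3` are joined to the legs `j` of the other vertex, the
leg `3` is external). [cite: Balaban1983Higgs3, (1.22) p.416] -/
def sg (nbar : ℕ) (i : Fin 2) (j : Fin 4) : SLeg (g318g nbar).kind := ⟨i, j⟩

/-- The vertex `i` (`i = 0`: `x`, `i = 1`: `x′`) of ⑥. [cite: Balaban1983Higgs3, (1.22) p.416] -/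
def vx6 (nbar : ℕ) (i : Fin 2) : Fin (g318g nbar).nV := i

/-- every φ′-leg of ⑥ is one of the eight `sg i j`. [cite: Balaban1983Higgs3, (1.22) p.416] -/
theorem sg_cases : ∀ ℓ : SLeg (g318g nbar).kind, ∃ i j, ℓ = sg nbar i j := fun ℓ => ⟨ℓ.1, ℓ.2, rfl⟩

/-- the eight legs are distinct. [cite: Balaban1983Higgs3, (1.22) p.416] -/
theorem sg_injective2 : ∀ i j i' j', sg nbar i j = sg nbar i' j' → i = i' ∧ j = j' := by
  show ∀ i j i' j', sg 0 i j = sg 0 i' j' → i = i' ∧ j = j'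
  decide

/-- **The φ′-lines of ⑥**: the leg `j < 3` of the vertex `i` is joined to the leg `j` of the other vertex. [cite: Balaban1983Higgs3, (1.22) p.416] -/
theorem sother6 (i : Fin 2) (j : Fin 4) (hj : j ≠ 3) :
    (sPairing (g318g nbar)).other (sg nbar i j) = some (sg nbar i.rev j) := by
  show spartner (g318g nbar) (sg nbar i j) = some (sg nbar i.rev j)
  refine (spartner_eq_some_iff _ _ _).2 ?_
  fin_cases i <;> fin_cases j <;> first | rfl | exact absurd rfl hj

/-- the fourth leg of each vertex of ⑥ is external. [cite: Balaban1983Higgs3, (1.22) p.416] -/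
theorem sother6_ext (i : Fin 2) : (sPairing (g318g nbar)).other (sg nbar i 3) = none := by
  show spartner (g318g nbar) (sg nbar i 3) = none
  refine (spartner_eq_none_iff _ _).2 ?_
  fin_cases i <;> rfl

/-- a leg of ⑥ is external iff it is a fourth leg. [cite: Balaban1983Higgs3, (1.22) p.416] -/
theorem sother6_none_iff : ∀ ℓ : SLeg (g318g nbar).kind,
    (sPairing (g318g nbar)).other ℓ = none ↔ ℓ = sg nbar 0 3 ∨ ℓ = sg nbar 1 3 := by
  show ∀ ℓ : SLeg (g318g 0).kind, (sPairing (g318g 0)).other ℓ = none ↔ ℓ = sg 0 0 3 ∨ ℓ = sg 0 1 3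
  decide

/-- the legs `0, 1, 2` of the vertex `x` are the lower endpoints of the three φ′-lines, and the only ones. [cite: Balaban1983Higgs3, (1.22) p.416] -/
theorem slower6_iff : ∀ ℓ : SLeg (g318g nbar).kind,
    (sPairing (g318g nbar)).isLower sRank ℓ = true ↔ ℓ = sg nbar 0 0 ∨ ℓ = sg nbar 0 1 ∨ ℓ = sg nbar 0 2 := by
  show ∀ ℓ : SLeg (g318g 0).kind,
    (sPairing (g318g 0)).isLower sRank ℓ = true ↔ ℓ = sg 0 0 0 ∨ ℓ = sg 0 0 1 ∨ ℓ = sg 0 0 2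
  decide

/-- The φ′-line of ⑥ through the legs `0` (lower endpoint at `x`, mate at `x′`). [cite: Balaban1983Higgs3, (1.22) p.416] -/
def l60 (nbar : ℕ) : SLine (g318g nbar) := ⟨sg nbar 0 0, (slower6_iff _).2 (Or.inl rfl)⟩

/-- The φ′-line of ⑥ through the legs `1`. [cite: Balaban1983Higgs3, (1.22) p.416] -/
def l61 (nbar : ℕ) : SLine (g318g nbar) := ⟨sg nbar 0 1, (slower6_iff _).2 (Or.inr (Or.inl rfl))⟩

/-- The φ′-line of ⑥ through the legs `2`. [cite: Balaban1983Higgs3, (1.22) p.416] -/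
def l62 (nbar : ℕ) : SLine (g318g nbar) := ⟨sg nbar 0 2, (slower6_iff _).2 (Or.inr (Or.inr rfl))⟩

/-- the three lines are distinct. [cite: Balaban1983Higgs3, (1.22) p.416] -/
theorem l6_ne : l60 nbar ≠ l61 nbar ∧ l60 nbar ≠ l62 nbar ∧ l61 nbar ≠ l62 nbar :=
  ⟨fun h => absurd (sg_injective2 0 0 0 1 (congrArg Subtype.val h)).2 (by decide),
    fun h => absurd (sg_injective2 0 0 0 2 (congrArg Subtype.val h)).2 (by decide),
    fun h => absurd (sg_injective2 0 1 0 2 (congrArg Subtype.val h)).2 (by decide)⟩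

/-- the φ′-lines of ⑥ are exactly `l60`, `l61`, `l62`. [cite: Balaban1983Higgs3, (1.22) p.416] -/
theorem univ_sline6 : (univ : Finset (SLine (g318g nbar))) = {l60 nbar, l61 nbar, l62 nbar} := by
  ext l
  simp only [Finset.mem_univ, Finset.mem_insert, Finset.mem_singleton, true_iff]
  rcases (slower6_iff l.1).1 l.2 with h | h | h
  · exact Or.inl (Subtype.ext h)
  · exact Or.inr (Or.inl (Subtype.ext h))
  · exact Or.inr (Or.inr (Subtype.ext h))

/-- the mates: the leg `j < 3` of `x` ↦ the leg `j` of `x′`. [cite: Balaban1983Higgs3, (1.22) p.416] -/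
theorem smate6 : (sPairing (g318g nbar)).mate (sg nbar 0 0) = sg nbar 1 0 ∧ (sPairing (g318g nbar)).mate (sg nbar 0 1) = sg nbar 1 1 ∧
    (sPairing (g318g nbar)).mate (sg nbar 0 2) = sg nbar 1 2 :=
  ⟨(sPairing (g318g nbar)).mate_eq (sother6 0 0 (by decide)), (sPairing (g318g nbar)).mate_eq (sother6 0 1 (by decide)),
    (sPairing (g318g nbar)).mate_eq (sother6 0 2 (by decide))⟩

/-- ⑥ has no A′-leg. [cite: Balaban1983Higgs3, (1.22) p.416] -/
instance instIsEmptyVLeg6 : IsEmpty (VLeg (g318g nbar).kind) := ⟨fun ℓ => Fin.elim0 (ℓ.2 : Fin 0)⟩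

/-- ⑥ has no averaging output. [cite: Balaban1983Higgs3, (1.22) p.416] -/
instance instIsEmptyOLeg6 : IsEmpty (OLeg (g318g nbar).kind) := ⟨fun ℓ => Fin.elim0 (ℓ.2 : Fin 0)⟩

/-- ⑥ has no A′-line. [cite: Balaban1983Higgs3, (1.22) p.416] -/
instance instIsEmptyVLine6 : IsEmpty (VLine (g318g nbar)) := ⟨fun l => IsEmpty.false l.1⟩

/-- ⑥ has no external A′-leg. [cite: Balaban1983Higgs3, (1.22) p.416] -/
instance instIsEmptyExtVLeg6 : IsEmpty (ExtVLeg (g318g nbar)) := ⟨fun l => IsEmpty.false l.1⟩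

/-- The external φ′-leg of the vertex `i` of ⑥ (its fourth leg). [cite: Balaban1983Higgs3, (1.22) p.416] -/
def ee6 (nbar : ℕ) (i : Fin 2) : ExtSLeg (g318g nbar) := ⟨sg nbar i 3, sother6_ext i⟩

/-- `ee6 0 ≠ ee6 1`. [cite: Balaban1983Higgs3, (1.22) p.416] -/
theorem ee6_0_ne_1 : ee6 nbar 0 ≠ ee6 nbar 1 := fun h => absurd (sg_injective2 0 3 1 3 (congrArg Subtype.val h)).1 (by decide)

/-- the external φ′-legs of ⑥ are exactly `ee6 0`, `ee6 1`. [cite: Balaban1983Higgs3, (1.22) p.416] -/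
theorem univ_extSLeg6 : (univ : Finset (ExtSLeg (g318g nbar))) = {ee6 nbar 0, ee6 nbar 1} := by
  ext l
  simp only [Finset.mem_univ, Finset.mem_insert, Finset.mem_singleton, true_iff]
  rcases (sother6_none_iff l.1).1 l.2 with h | h
  · left; exact Subtype.ext h
  · right; exact Subtype.ext h

end Legs6

/-! ## §5 ⑥ evaluated: `E = λ² Σ_{x,x′∈Ω₁} w₀(x)w₁(x′) η^{2d} Σ_{a,a′,c,c′} Ks₀((x,a),(x′,a′)) Ks₁((x,a),(x′,a′)) Ks₂((x,c),(x′,c′)) Φ((x,c),(x′,c′))` -/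

section Eval6

variable {P : HiggsLattice.Params} {N k : ℕ}

/-- every φ′-leg of ⑥, explicitly. [cite: Balaban1983Higgs3, (1.22) p.416] -/
theorem sg_cases8 : ∀ ℓ : SLeg (g318g nbar).kind,
    ℓ = sg nbar 0 0 ∨ ℓ = sg nbar 0 1 ∨ ℓ = sg nbar 0 2 ∨ ℓ = sg nbar 0 3 ∨
      ℓ = sg nbar 1 0 ∨ ℓ = sg nbar 1 1 ∨ ℓ = sg nbar 1 2 ∨ ℓ = sg nbar 1 3 := by
  show ∀ ℓ : SLeg (g318g 0).kind,
    ℓ = sg 0 0 0 ∨ ℓ = sg 0 0 1 ∨ ℓ = sg 0 0 2 ∨ ℓ = sg 0 0 3 ∨ ℓ = sg 0 1 0 ∨ ℓ = sg 0 1 1 ∨ ℓ = sg 0 1 2 ∨ ℓ = sg 0 1 3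
  decide

/-- **The polarized (1.6) on basis fields**: `−λ Σ_{x∈Ω₁} w(x) η^d (δ_{p₀}(x)·δ_{p₁}(x))(δ_{p₂}(x)·δ_{p₃}(x))` = Kronecker deltas putting
the legs 0, 1 at `x` with a common internal index and the legs 2, 3 at `x` with a common internal index (any level `j`).
[cite: Balaban1983Higgs3, (1.6) p.413] -/
theorem rule16_basisE {j : ℕ} (lamRun : ℝ) (Ω₁ : Finset (HiggsLattice.Site P j)) (w : HiggsLattice.Site P j → ℝ)
    (p : Fin 4 → HiggsLattice.Site P j × Fin N) :
    rule16 lamRun Ω₁ w (fun i => basisE (p i)) =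
      ∑ x ∈ Ω₁, (-(lamRun * (w x * P.mesh j ^ P.d))) *
        ((if x = (p 0).1 ∧ x = (p 1).1 ∧ (p 0).2 = (p 1).2 then (1 : ℝ) else 0) *
          (if x = (p 2).1 ∧ x = (p 3).1 ∧ (p 2).2 = (p 3).2 then (1 : ℝ) else 0)) := by
  unfold rule16
  simp only [inner_basisE]
  rw [Finset.mul_sum, ← Finset.sum_neg_distrib]
  exact Finset.sum_congr rfl fun x _ => by ring

/-- The index assignment of ⑥ determined by the deltas: at `x` the legs 0, 1 carry the index `a` and the legs 2, 3 the index `c`;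
at `x′` the legs 0, 1 carry `a′` and the legs 2, 3 carry `c′` (`q = ((a,c),(a′,c′))`). [cite: Balaban1983Higgs3, (1.22) p.416] -/
def assign6 (x x' : HiggsLattice.Site P 0) (q : (Fin N × Fin N) × (Fin N × Fin N)) :
    SLeg (g318g nbar).kind → HiggsLattice.Site P 0 × Fin N :=
  fun ℓ => if ℓ.1.val = 0 then (x, if ℓ.2.val < 2 then q.1.1 else q.1.2) else (x', if ℓ.2.val < 2 then q.2.1 else q.2.2)

/-- the values of `assign6` on the eight legs. [cite: Balaban1983Higgs3, (1.22) p.416] -/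
theorem assign6_apply (x x' : HiggsLattice.Site P 0) (q : (Fin N × Fin N) × (Fin N × Fin N)) :
    assign6 (nbar := nbar) x x' q (sg nbar 0 0) = (x, q.1.1) ∧ assign6 (nbar := nbar) x x' q (sg nbar 0 1) = (x, q.1.1) ∧
    assign6 (nbar := nbar) x x' q (sg nbar 0 2) = (x, q.1.2) ∧ assign6 (nbar := nbar) x x' q (sg nbar 0 3) = (x, q.1.2) ∧
    assign6 (nbar := nbar) x x' q (sg nbar 1 0) = (x', q.2.1) ∧ assign6 (nbar := nbar) x x' q (sg nbar 1 1) = (x', q.2.1) ∧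
    assign6 (nbar := nbar) x x' q (sg nbar 1 2) = (x', q.2.2) ∧ assign6 (nbar := nbar) x x' q (sg nbar 1 3) = (x', q.2.2) := by
  have t0 : ((0 : Fin 4) : ℕ) < 2 := by decide
  have t1 : ((1 : Fin 4) : ℕ) < 2 := by decide
  have t2 : ¬((2 : Fin 4) : ℕ) < 2 := by decide
  have t3 : ¬((3 : Fin 4) : ℕ) < 2 := by decide
  have h0 : ((0 : Fin 2) : ℕ) = 0 := by decide
  have h1 : ¬((1 : Fin 2) : ℕ) = 0 := by decide
  refine ⟨?_, ?_, ?_, ?_, ?_, ?_, ?_, ?_⟩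
  · show (if ((0 : Fin 2) : ℕ) = 0 then (x, if ((0 : Fin 4) : ℕ) < 2 then q.1.1 else q.1.2)
        else (x', if ((0 : Fin 4) : ℕ) < 2 then q.2.1 else q.2.2)) = _
    rw [if_pos h0, if_pos t0]
  · show (if ((0 : Fin 2) : ℕ) = 0 then (x, if ((1 : Fin 4) : ℕ) < 2 then q.1.1 else q.1.2)
        else (x', if ((1 : Fin 4) : ℕ) < 2 then q.2.1 else q.2.2)) = _
    rw [if_pos h0, if_pos t1]
  · show (if ((0 : Fin 2) : ℕ) = 0 then (x, if ((2 : Fin 4) : ℕ) < 2 then q.1.1 else q.1.2)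
        else (x', if ((2 : Fin 4) : ℕ) < 2 then q.2.1 else q.2.2)) = _
    rw [if_pos h0, if_neg t2]
  · show (if ((0 : Fin 2) : ℕ) = 0 then (x, if ((3 : Fin 4) : ℕ) < 2 then q.1.1 else q.1.2)
        else (x', if ((3 : Fin 4) : ℕ) < 2 then q.2.1 else q.2.2)) = _
    rw [if_pos h0, if_neg t3]
  · show (if ((1 : Fin 2) : ℕ) = 0 then (x, if ((0 : Fin 4) : ℕ) < 2 then q.1.1 else q.1.2)
        else (x', if ((0 : Fin 4) : ℕ) < 2 then q.2.1 else q.2.2)) = _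
    rw [if_neg h1, if_pos t0]
  · show (if ((1 : Fin 2) : ℕ) = 0 then (x, if ((1 : Fin 4) : ℕ) < 2 then q.1.1 else q.1.2)
        else (x', if ((1 : Fin 4) : ℕ) < 2 then q.2.1 else q.2.2)) = _
    rw [if_neg h1, if_pos t1]
  · show (if ((1 : Fin 2) : ℕ) = 0 then (x, if ((2 : Fin 4) : ℕ) < 2 then q.1.1 else q.1.2)
        else (x', if ((2 : Fin 4) : ℕ) < 2 then q.2.1 else q.2.2)) = _
    rw [if_neg h1, if_neg t2]
  · show (if ((1 : Fin 2) : ℕ) = 0 then (x, if ((3 : Fin 4) : ℕ) < 2 then q.1.1 else q.1.2)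
        else (x', if ((3 : Fin 4) : ℕ) < 2 then q.2.1 else q.2.2)) = _
    rw [if_neg h1, if_neg t3]

/-- `assign6 x x′` is injective. [cite: Balaban1983Higgs3, (1.22) p.416] -/
theorem assign6_injective (x x' : HiggsLattice.Site P 0) : Function.Injective (assign6 (nbar := nbar) (N := N) x x') := by
  rintro ⟨⟨a, c⟩, ⟨a', c'⟩⟩ ⟨⟨b, d⟩, ⟨b', d'⟩⟩ h
  obtain ⟨e00, -, e02, -, e10, -, e12, -⟩ := assign6_apply (nbar := nbar) x x' ((a, c), (a', c'))
  obtain ⟨f00, -, f02, -, f10, -, f12, -⟩ := assign6_apply (nbar := nbar) x x' ((b, d), (b', d'))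
  have h00 := congrFun h (sg nbar 0 0)
  have h02 := congrFun h (sg nbar 0 2)
  have h10 := congrFun h (sg nbar 1 0)
  have h12 := congrFun h (sg nbar 1 2)
  rw [e00, f00] at h00
  rw [e02, f02] at h02
  rw [e10, f10] at h10
  rw [e12, f12] at h12
  simp only [Prod.mk.injEq, true_and] at h00 h02 h10 h12
  rw [h00, h02, h10, h12]

/-- The external legs of ⑥ at `(x, c)`, `(x′, c′)`. [cite: Balaban1983Higgs3, (1.22) p.416] -/
def extAt6 (x x' : HiggsLattice.Site P 0) (c c' : Fin N) : ExtSLeg (g318g nbar) → HiggsLattice.Site P 0 × Fin N :=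
  fun ℓ => if ℓ = ee6 nbar 0 then (x, c) else (x', c')

/-- on `assign6 x x′ ((a,c),(a′,c′))` the external legs sit at `(x, c)`, `(x′, c′)`. [cite: Balaban1983Higgs3, (1.22) p.416] -/
theorem assign6_ext (x x' : HiggsLattice.Site P 0) (q : (Fin N × Fin N) × (Fin N × Fin N)) :
    (fun ℓ : ExtSLeg (g318g nbar) => assign6 x x' q ℓ.1) = extAt6 x x' q.1.2 q.2.2 := by
  obtain ⟨-, -, -, e03, -, -, -, e13⟩ := assign6_apply (nbar := nbar) x x' q
  funext ℓ
  unfold extAt6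
  rcases (sother6_none_iff ℓ.1).1 ℓ.2 with h | h
  · rw [h, e03, if_pos (Subtype.ext h)]
  · rw [h, e13, if_neg (fun h' => absurd (h.symm.trans (congrArg Subtype.val h')) (fun e => absurd (sg_injective2 1 3 0 3 e).1 (by decide)))]

/-- kernel: the Kronecker sum over the φ′-leg assignments of ⑥ — the four delta pairs of the two (1.6) vertices at `x`, `x′` leave the
four internal indices `a, c` (at `x`) and `a′, c′` (at `x′`). [folklore] -/
private theorem sdelta_sum6 (x x' : HiggsLattice.Site P 0) (F : (SLeg (g318g nbar).kind → HiggsLattice.Site P 0 × Fin N) → ℝ) :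
    ∑ α : SLeg (g318g nbar).kind → HiggsLattice.Site P 0 × Fin N,
        ((if x = (α (sg nbar 0 0)).1 ∧ x = (α (sg nbar 0 1)).1 ∧ (α (sg nbar 0 0)).2 = (α (sg nbar 0 1)).2 then (1 : ℝ) else 0) *
          (if x = (α (sg nbar 0 2)).1 ∧ x = (α (sg nbar 0 3)).1 ∧ (α (sg nbar 0 2)).2 = (α (sg nbar 0 3)).2 then (1 : ℝ) else 0)) *
        ((if x' = (α (sg nbar 1 0)).1 ∧ x' = (α (sg nbar 1 1)).1 ∧ (α (sg nbar 1 0)).2 = (α (sg nbar 1 1)).2 then (1 : ℝ) else 0) *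
          (if x' = (α (sg nbar 1 2)).1 ∧ x' = (α (sg nbar 1 3)).1 ∧ (α (sg nbar 1 2)).2 = (α (sg nbar 1 3)).2 then (1 : ℝ) else 0)) *
        F α =
      ∑ a : Fin N, ∑ c : Fin N, ∑ a' : Fin N, ∑ c' : Fin N, F (assign6 x x' ((a, c), (a', c'))) := by
  classical
  set S : Finset (SLeg (g318g nbar).kind → HiggsLattice.Site P 0 × Fin N) := univ.image (assign6 x x') with hS
  rw [← Finset.sum_subset (Finset.subset_univ S)]
  · rw [hS, Finset.sum_image fun q _ q' _ h => assign6_injective x x' h]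
    have hterm : ∀ q : (Fin N × Fin N) × (Fin N × Fin N),
        ((if x = (assign6 (nbar := nbar) x x' q (sg nbar 0 0)).1 ∧ x = (assign6 (nbar := nbar) x x' q (sg nbar 0 1)).1 ∧
              (assign6 (nbar := nbar) x x' q (sg nbar 0 0)).2 = (assign6 (nbar := nbar) x x' q (sg nbar 0 1)).2 then (1 : ℝ) else 0) *
          (if x = (assign6 (nbar := nbar) x x' q (sg nbar 0 2)).1 ∧ x = (assign6 (nbar := nbar) x x' q (sg nbar 0 3)).1 ∧
              (assign6 (nbar := nbar) x x' q (sg nbar 0 2)).2 = (assign6 (nbar := nbar) x x' q (sg nbar 0 3)).2 then (1 : ℝ) else 0)) *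
        ((if x' = (assign6 (nbar := nbar) x x' q (sg nbar 1 0)).1 ∧ x' = (assign6 (nbar := nbar) x x' q (sg nbar 1 1)).1 ∧
              (assign6 (nbar := nbar) x x' q (sg nbar 1 0)).2 = (assign6 (nbar := nbar) x x' q (sg nbar 1 1)).2 then (1 : ℝ) else 0) *
          (if x' = (assign6 (nbar := nbar) x x' q (sg nbar 1 2)).1 ∧ x' = (assign6 (nbar := nbar) x x' q (sg nbar 1 3)).1 ∧
              (assign6 (nbar := nbar) x x' q (sg nbar 1 2)).2 = (assign6 (nbar := nbar) x x' q (sg nbar 1 3)).2 then (1 : ℝ) else 0)) *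
          F (assign6 x x' q) = F (assign6 x x' q) := by
      intro q
      obtain ⟨e00, e01, e02, e03, e10, e11, e12, e13⟩ := assign6_apply (nbar := nbar) x x' q
      rw [e00, e01, e02, e03, e10, e11, e12, e13]
      simp
    simp only [hterm]
    rw [Fintype.sum_prod_type, Fintype.sum_prod_type]
    simp only [Fintype.sum_prod_type]
  · intro α _ hα
    by_cases h00 : x = (α (sg nbar 0 0)).1 ∧ x = (α (sg nbar 0 1)).1 ∧ (α (sg nbar 0 0)).2 = (α (sg nbar 0 1)).2
    · by_cases h02 : x = (α (sg nbar 0 2)).1 ∧ x = (α (sg nbar 0 3)).1 ∧ (α (sg nbar 0 2)).2 = (α (sg nbar 0 3)).2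
      · by_cases h10 : x' = (α (sg nbar 1 0)).1 ∧ x' = (α (sg nbar 1 1)).1 ∧ (α (sg nbar 1 0)).2 = (α (sg nbar 1 1)).2
        · by_cases h12 : x' = (α (sg nbar 1 2)).1 ∧ x' = (α (sg nbar 1 3)).1 ∧ (α (sg nbar 1 2)).2 = (α (sg nbar 1 3)).2
          · exfalso
            apply hα
            rw [hS, Finset.mem_image]
            refine ⟨(((α (sg nbar 0 0)).2, (α (sg nbar 0 2)).2), ((α (sg nbar 1 0)).2, (α (sg nbar 1 2)).2)), Finset.mem_univ _, ?_⟩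
            obtain ⟨e00, e01, e02, e03, e10, e11, e12, e13⟩ :=
              assign6_apply (nbar := nbar) x x' (((α (sg nbar 0 0)).2, (α (sg nbar 0 2)).2), ((α (sg nbar 1 0)).2, (α (sg nbar 1 2)).2))
            funext ℓ
            rcases sg_cases8 ℓ with h | h | h | h | h | h | h | h <;> rw [h]
            · rw [e00]; exact Prod.ext h00.1 rfl
            · rw [e01]; exact Prod.ext h00.2.1 h00.2.2
            · rw [e02]; exact Prod.ext h02.1 rfl
            · rw [e03]; exact Prod.ext h02.2.1 h02.2.2
            · rw [e10]; exact Prod.ext h10.1 rfl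
            · rw [e11]; exact Prod.ext h10.2.1 h10.2.2
            · rw [e12]; exact Prod.ext h12.1 rfl
            · rw [e13]; exact Prod.ext h12.2.1 h12.2.2
          · rw [if_neg h12]; ring
        · rw [if_neg h10]; ring
      · rw [if_neg h02]; ring
    · rw [if_neg h00]; ring

/-- A PRODUCT external field of ⑥ at the contributing assignments: `φ(x)_c · φ′(x′)_{c′}`. [cite: Balaban1983Higgs3, p.419] -/
theorem extS_extAt6 (φ : ExtSLeg (g318g nbar) → HiggsLattice.ScalarField P 0 N) (x x' : HiggsLattice.Site P 0) (c c' : Fin N) :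
    extS (g318g nbar) φ (extAt6 x x' c c') = φ (ee6 nbar 0) x c * φ (ee6 nbar 1) x' c' := by
  unfold extS
  rw [show (∏ ℓ : ExtSLeg (g318g nbar), φ ℓ (extAt6 x x' c c' ℓ).1 (extAt6 x x' c c' ℓ).2) =
      ∏ ℓ ∈ ({ee6 nbar 0, ee6 nbar 1} : Finset _), φ ℓ (extAt6 x x' c c' ℓ).1 (extAt6 x x' c c' ℓ).2 by rw [← univ_extSLeg6],
    Finset.prod_pair ee6_0_ne_1]
  unfold extAt6
  rw [if_pos rfl, if_neg (Ne.symm ee6_0_ne_1)]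

/-- kernel: the scalar product of `W = ℝ^N` in coordinates. [folklore] -/
private theorem inner_eq_sum_coord (u v : HiggsCovariance.E N) : ⟪u, v⟫_ℝ = ∑ a, u a * v a := by
  rw [PiLp.inner_apply]
  simp [mul_comm]

variable [DecidableEq (HiggsLattice.PBond P 0)]

/-- **The evaluator EVALUATED on the picture ⑥ of (1.22) (= (3.18)₇, the sunset: two vertices (1.6) joined by three φ′-lines)**: for the
model data `M`, the localization weights `w₀`, `w₁` of the two vertices, any three scalar line kernels `Ks` and any joint external
scalar field `Φ`, the expression of p18's graph `g318g` is
`E = λ² Σ_{x,x′∈Ω₁} w₀(x)w₁(x′) η^{2d} Σ_{a,c,a′,c′} Ks₀((x,a),(x′,a′))·Ks₁((x,a),(x′,a′))·Ks₂((x,c),(x′,c′))·Φ((x,c),(x′,c′))` — the two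
lines leaving the same scalar product of (1.6) carry a common internal index at each end (a closed index loop), the third line carries
the index of the external leg it shares a scalar product with; sign `(−λ)² = λ²`. [cite: Balaban1983Higgs3, (1.22) p.416]
[cite: Balaban1983Higgs3, (3.18) p.438] -/
theorem graphAmp_g318g (M : Model P N k) (dm2 : Fin (g318g nbar).nV → HiggsLattice.Site P 0 → ℝ)
    (loc : Fin (g318g nbar).nV → Loc P k) (Po : OutPairing (g318g nbar))
    (Ks : SLine (g318g nbar) → HiggsLattice.Site P 0 × Fin N → HiggsLattice.Site P 0 × Fin N → ℝ)
    (Kv : VLine (g318g nbar) → HiggsLattice.PBond P 0 → HiggsLattice.PBond P 0 → ℝ)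
    (Ko : Po.Line oRank → HiggsLattice.Site P k × Fin N → HiggsLattice.Site P k × Fin N → ℝ)
    (Φ : (ExtSLeg (g318g nbar) → HiggsLattice.Site P 0 × Fin N) → ℝ) :
    graphAmp (g318g nbar) M dm2 loc Po Ks Kv Ko Φ (fun _ => 1) (fun _ => 1) =
      M.lamRun ^ 2 * ∑ x ∈ M.Ω₁, ∑ x' ∈ M.Ω₁, (loc (vx6 nbar 0)).wS x * (loc (vx6 nbar 1)).wS x' * (P.mesh 0 ^ P.d) ^ 2 *
        ∑ a : Fin N, ∑ c : Fin N, ∑ a' : Fin N, ∑ c' : Fin N,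
          Ks (l60 nbar) (x, a) (x', a') * Ks (l61 nbar) (x, a) (x', a') * Ks (l62 nbar) (x, c) (x', c') * Φ (extAt6 x x' c c') := by
  haveI : IsEmpty (Po.Line oRank) := ⟨fun l => IsEmpty.false l.1⟩
  have hV : ∀ (α : SLeg (g318g nbar).kind → HiggsLattice.Site P 0 × Fin N)
      (β : VLeg (g318g nbar).kind → HiggsLattice.PBond P 0) (ο : OLeg (g318g nbar).kind → HiggsLattice.Site P k × Fin N),
      vertexFactor (rulesOf (g318g nbar) M dm2 loc) basisE basisV basisE α β ο =
        rule16 M.lamRun M.Ω₁ (loc (vx6 nbar 0)).wS (fun j => basisE (α (sg nbar 0 j))) *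
          rule16 M.lamRun M.Ω₁ (loc (vx6 nbar 1)).wS (fun j => basisE (α (sg nbar 1 j))) := by
    intro α β ο
    unfold vertexFactor
    exact Fin.prod_univ_two _
  have hs : ∀ α : SLeg (g318g nbar).kind → HiggsLattice.Site P 0 × Fin N,
      sLineFactor Ks α = Ks (l60 nbar) (α (sg nbar 0 0)) (α (sg nbar 1 0)) *
        (Ks (l61 nbar) (α (sg nbar 0 1)) (α (sg nbar 1 1)) * Ks (l62 nbar) (α (sg nbar 0 2)) (α (sg nbar 1 2))) := by
    intro α
    unfold sLineFactor
    rw [show (∏ l : SLine (g318g nbar), Ks l (α l.1) (α ((sPairing (g318g nbar)).mate l.1))) =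
        ∏ l ∈ ({l60 nbar, l61 nbar, l62 nbar} : Finset _), Ks l (α l.1) (α ((sPairing (g318g nbar)).mate l.1)) by rw [← univ_sline6],
      Finset.prod_insert (by simp only [Finset.mem_insert, Finset.mem_singleton, not_or]; exact ⟨l6_ne.1, l6_ne.2.1⟩),
      Finset.prod_pair l6_ne.2.2]
    show Ks (l60 nbar) (α (sg nbar 0 0)) (α ((sPairing (g318g nbar)).mate (sg nbar 0 0))) *
        (Ks (l61 nbar) (α (sg nbar 0 1)) (α ((sPairing (g318g nbar)).mate (sg nbar 0 1))) *
          Ks (l62 nbar) (α (sg nbar 0 2)) (α ((sPairing (g318g nbar)).mate (sg nbar 0 2)))) = _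
    rw [smate6.1, smate6.2.1, smate6.2.2]
  have hv : ∀ β : VLeg (g318g nbar).kind → HiggsLattice.PBond P 0, vLineFactor (G := g318g nbar) Kv β = 1 := by
    intro β
    unfold vLineFactor
    exact Fintype.prod_empty _
  have ho : ∀ ο : OLeg (g318g nbar).kind → HiggsLattice.Site P k × Fin N, oLineFactor Po Ko ο = 1 := by
    intro ο
    unfold oLineFactor
    exact Fintype.prod_empty _
  unfold graphAmp amp
  simp only [Fintype.sum_unique, hV, hs, hv, ho, mul_one, rule16_basisE]
  -- abbreviations for the delta factors
  set D0 : (SLeg (g318g nbar).kind → HiggsLattice.Site P 0 × Fin N) → HiggsLattice.Site P 0 → ℝ := fun α x =>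
    (if x = (α (sg nbar 0 0)).1 ∧ x = (α (sg nbar 0 1)).1 ∧ (α (sg nbar 0 0)).2 = (α (sg nbar 0 1)).2 then (1 : ℝ) else 0) *
      (if x = (α (sg nbar 0 2)).1 ∧ x = (α (sg nbar 0 3)).1 ∧ (α (sg nbar 0 2)).2 = (α (sg nbar 0 3)).2 then (1 : ℝ) else 0) with hD0
  set D1 : (SLeg (g318g nbar).kind → HiggsLattice.Site P 0 × Fin N) → HiggsLattice.Site P 0 → ℝ := fun α x' =>
    (if x' = (α (sg nbar 1 0)).1 ∧ x' = (α (sg nbar 1 1)).1 ∧ (α (sg nbar 1 0)).2 = (α (sg nbar 1 1)).2 then (1 : ℝ) else 0) *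
      (if x' = (α (sg nbar 1 2)).1 ∧ x' = (α (sg nbar 1 3)).1 ∧ (α (sg nbar 1 2)).2 = (α (sg nbar 1 3)).2 then (1 : ℝ) else 0) with hD1
  set L : (SLeg (g318g nbar).kind → HiggsLattice.Site P 0 × Fin N) → ℝ := fun α =>
    Ks (l60 nbar) (α (sg nbar 0 0)) (α (sg nbar 1 0)) * Ks (l61 nbar) (α (sg nbar 0 1)) (α (sg nbar 1 1)) *
      Ks (l62 nbar) (α (sg nbar 0 2)) (α (sg nbar 1 2)) * Φ (fun ℓ => α ℓ.1) with hL
  have h1 : ∀ α : SLeg (g318g nbar).kind → HiggsLattice.Site P 0 × Fin N,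
      (∑ x ∈ M.Ω₁, (-(M.lamRun * ((loc (vx6 nbar 0)).wS x * P.mesh 0 ^ P.d))) * D0 α x) *
          (∑ x' ∈ M.Ω₁, (-(M.lamRun * ((loc (vx6 nbar 1)).wS x' * P.mesh 0 ^ P.d))) * D1 α x') *
          Φ (fun ℓ => α ℓ.1) *
          (Ks (l60 nbar) (α (sg nbar 0 0)) (α (sg nbar 1 0)) *
            (Ks (l61 nbar) (α (sg nbar 0 1)) (α (sg nbar 1 1)) * Ks (l62 nbar) (α (sg nbar 0 2)) (α (sg nbar 1 2)))) =
        ∑ x ∈ M.Ω₁, ∑ x' ∈ M.Ω₁, (M.lamRun ^ 2 * ((loc (vx6 nbar 0)).wS x * (loc (vx6 nbar 1)).wS x' * (P.mesh 0 ^ P.d) ^ 2)) *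
          (D0 α x * D1 α x' * L α) := by
    intro α
    rw [Finset.sum_mul_sum, Finset.sum_mul, Finset.sum_mul]
    refine Finset.sum_congr rfl fun x _ => ?_
    rw [Finset.sum_mul, Finset.sum_mul]
    refine Finset.sum_congr rfl fun x' _ => ?_
    rw [hL]
    ring
  rw [Finset.sum_congr rfl fun α _ => h1 α, Finset.sum_comm]
  rw [Finset.mul_sum]
  refine Finset.sum_congr rfl fun x _ => ?_
  rw [Finset.sum_comm, Finset.mul_sum]
  refine Finset.sum_congr rfl fun x' _ => ?_
  rw [← Finset.mul_sum]
  have h2 := sdelta_sum6 (nbar := nbar) x x' L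
  simp only [hD0, hD1] at h2 ⊢
  rw [h2]
  simp only [hL, assign6_ext]
  obtain h3 := fun q : (Fin N × Fin N) × (Fin N × Fin N) => assign6_apply (nbar := nbar) x x' q
  simp only [(h3 _).1, (h3 _).2.1, (h3 _).2.2.1, (h3 _).2.2.2.2.1, (h3 _).2.2.2.2.2.1, (h3 _).2.2.2.2.2.2.1]
  ring

end Eval6

/-! ## §6 ⑥ for product external fields and at print's data: the sixth term of (1.22) -/

section Free6

variable {P : HiggsLattice.Params} {N k : ℕ}

/-- kernel: the scalar product of `W = ℝ^N` in coordinates. [folklore] -/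
private theorem inner_eq_sum_coord6 (u v : HiggsCovariance.E N) : ⟪u, v⟫_ℝ = ∑ a, u a * v a := by
  rw [PiLp.inner_apply]
  simp [mul_comm]

/-- kernel: the index sums of ⑥ with the free propagator — the closed loop of the lines 0, 1 gives `N`, the line 2 carries the
external index: `Σ_{a,c,a′,c′} [a = a′]C·[a = a′]C·[c = c′]C·u_c v_{c′} = N·C³·(u·v)`. [folklore] -/
private theorem loop_sum6 (C : ℝ) (u v : HiggsCovariance.E N) :
    ∑ a : Fin N, ∑ c : Fin N, ∑ a' : Fin N, ∑ c' : Fin N,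
        (if a = a' then C else 0) * (if a = a' then C else 0) * (if c = c' then C else 0) * (u c * v c') =
      (N : ℝ) * (C ^ 3 * ⟪u, v⟫_ℝ) := by
  have h1 : ∀ a c a' : Fin N, ∑ c' : Fin N,
      (if a = a' then C else 0) * (if a = a' then C else 0) * (if c = c' then C else 0) * (u c * v c') =
        (if a = a' then C else 0) * (if a = a' then C else 0) * (C * (u c * v c)) := by
    intro a c a'
    have h2 : ∀ c' : Fin N, (if a = a' then C else 0) * (if a = a' then C else 0) * (if c = c' then C else 0) * (u c * v c') =
        if c = c' then (if a = a' then C else 0) * (if a = a' then C else 0) * (C * (u c * v c')) else 0 := by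
      intro c'
      split_ifs <;> ring
    rw [Finset.sum_congr rfl fun c' _ => h2 c', Finset.sum_ite_eq]
    simp
  have h3 : ∀ a c : Fin N, ∑ a' : Fin N, (if a = a' then C else 0) * (if a = a' then C else 0) * (C * (u c * v c)) =
      C ^ 3 * (u c * v c) := by
    intro a c
    have h4 : ∀ a' : Fin N, (if a = a' then C else 0) * (if a = a' then C else 0) * (C * (u c * v c)) =
        if a = a' then C ^ 3 * (u c * v c) else 0 := by
      intro a'
      split_ifs <;> ring
    rw [Finset.sum_congr rfl fun a' _ => h4 a', Finset.sum_ite_eq]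
    simp
  have h5 : ∀ a : Fin N, ∑ c : Fin N, ∑ a' : Fin N, ∑ c' : Fin N,
      (if a = a' then C else 0) * (if a = a' then C else 0) * (if c = c' then C else 0) * (u c * v c') = C ^ 3 * ⟪u, v⟫_ℝ := by
    intro a
    rw [Finset.sum_congr rfl fun c _ => by rw [Finset.sum_congr rfl fun a' _ => h1 a c a', h3 a c], ← Finset.mul_sum,
      inner_eq_sum_coord6]
  rw [Finset.sum_congr rfl fun a _ => h5 a, Finset.sum_const, Finset.card_univ, Fintype.card_fin, nsmul_eq_mul]

/-- The two external fields of ⑥: `φ` on the external leg at `x`, `φ′` on the external leg at `x′`. [cite: Balaban1983Higgs3, (1.22) p.416] -/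
def pairExt6 (φ φ' : HiggsLattice.ScalarField P 0 N) : ExtSLeg (g318g nbar) → HiggsLattice.ScalarField P 0 N :=
  fun ℓ => if ℓ = ee6 nbar 0 then φ else φ'

/-- `pairExt6` on the two legs. [cite: Balaban1983Higgs3, (1.22) p.416] -/
theorem pairExt6_apply (φ φ' : HiggsLattice.ScalarField P 0 N) :
    pairExt6 (nbar := nbar) φ φ' (ee6 nbar 0) = φ ∧ pairExt6 (nbar := nbar) φ φ' (ee6 nbar 1) = φ' :=
  ⟨if_pos rfl, if_neg (Ne.symm ee6_0_ne_1)⟩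

/-- **THE SIXTH TERM OF (1.22) as a bilinear form in the external fields**, on the (Higgs)₂,₃ torus carrier: print's
*"4²(2N+4)λ²(C^ε_0(x − x′))³"* (p. 416) inserted between `φ(x)` and `φ′(x′)`: `4²(2N+4)λ² Σ_{x,x′} ε^{2d} C₀(x,x′)³ φ(x)·φ′(x′)` —
`B3Eq123Counterterms.sig6` RESTATED symbol by symbol on this carrier (two-point kernel `C₀`, `N` the number of real components).
[cite: Balaban1983Higgs3, (1.22) p.416] -/
def sixth122T (ε lam : ℝ) (N' : ℕ) (C₀ : HiggsLattice.Site P 0 → HiggsLattice.Site P 0 → ℝ) (φ φ' : HiggsLattice.ScalarField P 0 N) : ℝ :=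
  4 ^ 2 * (2 * (N' : ℝ) + 4) * lam ^ 2 *
    ∑ x : HiggsLattice.Site P 0, ∑ x' : HiggsLattice.Site P 0, ε ^ (2 * P.d) * (C₀ x x' ^ 3 * ⟪φ x, φ' x'⟫_ℝ)

variable [DecidableEq (HiggsLattice.PBond P 0)]

/-- **⑥ for product external fields**: `E = λ² Σ_{x,x′∈Ω₁} w₀(x)w₁(x′) η^{2d} Σ_{a,c,a′,c′} Ks₀((x,a),(x′,a′))Ks₁((x,a),(x′,a′))Ks₂((x,c),(x′,c′))
φ(x)_c φ′(x′)_{c′}`. [cite: Balaban1983Higgs3, (1.22) p.416] [cite: Balaban1983Higgs3, (3.18) p.438] -/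
theorem graphAmp_g318g_extS (M : Model P N k) (dm2 : Fin (g318g nbar).nV → HiggsLattice.Site P 0 → ℝ)
    (loc : Fin (g318g nbar).nV → Loc P k) (Po : OutPairing (g318g nbar))
    (Ks : SLine (g318g nbar) → HiggsLattice.Site P 0 × Fin N → HiggsLattice.Site P 0 × Fin N → ℝ)
    (Kv : VLine (g318g nbar) → HiggsLattice.PBond P 0 → HiggsLattice.PBond P 0 → ℝ)
    (Ko : Po.Line oRank → HiggsLattice.Site P k × Fin N → HiggsLattice.Site P k × Fin N → ℝ)
    (φ : ExtSLeg (g318g nbar) → HiggsLattice.ScalarField P 0 N) :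
    graphAmp (g318g nbar) M dm2 loc Po Ks Kv Ko (extS (g318g nbar) φ) (fun _ => 1) (fun _ => 1) =
      M.lamRun ^ 2 * ∑ x ∈ M.Ω₁, ∑ x' ∈ M.Ω₁, (loc (vx6 nbar 0)).wS x * (loc (vx6 nbar 1)).wS x' * (P.mesh 0 ^ P.d) ^ 2 *
        ∑ a : Fin N, ∑ c : Fin N, ∑ a' : Fin N, ∑ c' : Fin N,
          Ks (l60 nbar) (x, a) (x', a') * Ks (l61 nbar) (x, a) (x', a') * Ks (l62 nbar) (x, c) (x', c') *
            (φ (ee6 nbar 0) x c * φ (ee6 nbar 1) x' c') := by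
  rw [graphAmp_g318g]
  simp only [extS_extAt6]

/-- **⑥ with the free scalar propagator on its three lines** (`Ks = C₀ ⊗ 1_N` on every line: *"The propagators are C^ε_0 for the scalar
field"*, internal indices *"understood"* = the identity, p. 416): the closed index loop of the two lines leaving the same scalar product
gives the factor `N = tr 1_W`, the third line carries the external index:
`E = λ²·N·Σ_{x,x′∈Ω₁} w₀(x)w₁(x′) η^{2d} C₀(x,x′)³ φ(x)·φ′(x′)`. [cite: Balaban1983Higgs3, (1.22) p.416] -/
theorem graphAmp_g318g_free (M : Model P N k) (dm2 : Fin (g318g nbar).nV → HiggsLattice.Site P 0 → ℝ)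
    (loc : Fin (g318g nbar).nV → Loc P k) (Po : OutPairing (g318g nbar))
    (Ks : SLine (g318g nbar) → HiggsLattice.Site P 0 × Fin N → HiggsLattice.Site P 0 × Fin N → ℝ)
    (Kv : VLine (g318g nbar) → HiggsLattice.PBond P 0 → HiggsLattice.PBond P 0 → ℝ)
    (Ko : Po.Line oRank → HiggsLattice.Site P k × Fin N → HiggsLattice.Site P k × Fin N → ℝ)
    (C₀ : HiggsLattice.Site P 0 → HiggsLattice.Site P 0 → ℝ) (hKs : ∀ l p p', Ks l p p' = if p.2 = p'.2 then C₀ p.1 p'.1 else 0)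
    (φ φ' : HiggsLattice.ScalarField P 0 N) :
    graphAmp (g318g nbar) M dm2 loc Po Ks Kv Ko (extS (g318g nbar) (pairExt6 φ φ')) (fun _ => 1) (fun _ => 1) =
      M.lamRun ^ 2 * ((N : ℝ) * ∑ x ∈ M.Ω₁, ∑ x' ∈ M.Ω₁, (loc (vx6 nbar 0)).wS x * (loc (vx6 nbar 1)).wS x' * (P.mesh 0 ^ P.d) ^ 2 *
        (C₀ x x' ^ 3 * ⟪φ x, φ' x'⟫_ℝ)) := by
  rw [graphAmp_g318g_extS]
  obtain ⟨e0, e1⟩ := pairExt6_apply (nbar := nbar) φ φ'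
  simp only [e0, e1, hKs]
  congr 1
  rw [Finset.mul_sum]
  refine Finset.sum_congr rfl fun x _ => ?_
  rw [Finset.mul_sum]
  refine Finset.sum_congr rfl fun x' _ => ?_
  rw [loop_sum6]
  ring

/-- **E(⑥) AGAINST THE SIXTH TERM OF (1.22)** at print's data of p. 416 (`Ω₁ = T_ε`, trivial localization, `η = ε`, free propagators):
`E = (N / (4²(2N+4)))·sixth122T` — the drawn labelled picture (p18's `g318g`: the legs `j ↔ j`, the two lines `0, 1` leaving ONE scalar
product of (1.6)) is ONE Wick term with a closed index loop (factor `N`); print's coefficient `4²(2N+4) = 32N + 64` counts all `4·4·3!`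
labelled pairings, `32` of which carry the loop factor `N` and `64` the single index chain (p. 416: *"we did not write … combinatoric
factors before the graphs"*). A reading note, not a claim about print. [cite: Balaban1983Higgs3, (1.22) p.416] -/
theorem graphAmp_g318g_print (M : Model P N k) (hΩ : M.Ω₁ = Finset.univ) (dm2 : Fin (g318g nbar).nV → HiggsLattice.Site P 0 → ℝ)
    (loc : Fin (g318g nbar).nV → Loc P k) (hw₀ : ∀ x, (loc (vx6 nbar 0)).wS x = 1) (hw₁ : ∀ x, (loc (vx6 nbar 1)).wS x = 1)
    (Po : OutPairing (g318g nbar)) (Ks : SLine (g318g nbar) → HiggsLattice.Site P 0 × Fin N → HiggsLattice.Site P 0 × Fin N → ℝ)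
    (Kv : VLine (g318g nbar) → HiggsLattice.PBond P 0 → HiggsLattice.PBond P 0 → ℝ)
    (Ko : Po.Line oRank → HiggsLattice.Site P k × Fin N → HiggsLattice.Site P k × Fin N → ℝ)
    (C₀ : HiggsLattice.Site P 0 → HiggsLattice.Site P 0 → ℝ) (hKs : ∀ l p p', Ks l p p' = if p.2 = p'.2 then C₀ p.1 p'.1 else 0)
    (φ φ' : HiggsLattice.ScalarField P 0 N) :
    graphAmp (g318g nbar) M dm2 loc Po Ks Kv Ko (extS (g318g nbar) (pairExt6 φ φ')) (fun _ => 1) (fun _ => 1) =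
      (N : ℝ) / (4 ^ 2 * (2 * (N : ℝ) + 4)) * sixth122T (P.mesh 0) M.lamRun N C₀ φ φ' := by
  rw [graphAmp_g318g_free M dm2 loc Po Ks Kv Ko C₀ hKs φ φ', sixth122T, hΩ]
  simp only [hw₀, hw₁, one_mul, ← pow_mul, mul_comm P.d 2]
  have hN : (4 : ℝ) ^ 2 * (2 * (N : ℝ) + 4) ≠ 0 := by positivity
  rw [div_mul_eq_mul_div, eq_div_iff hN]
  ring

end Free6

/-! ## §7 The picture ⑤ of (1.22) = (3.18)₁ (p18's `g318a`: two vertices (1.10)_{2,0} joined by one φ′-line and by both A′-lines) -/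

section Legs5

/-- The φ′-leg `j` of the vertex `i` of ⑤ (`j = 0`: joined to the leg `0` of the other vertex; `j = 1`: external).
[cite: Balaban1983Higgs3, (1.22) p.416] -/
def sa5 (nbar : ℕ) (hn2 : 2 ≤ nbar) (i j : Fin 2) : SLeg (g318a nbar hn2).kind := ⟨i, j⟩

/-- The A′-leg `j` of the vertex `i` of ⑤ (joined to the A′-leg `j` of the other vertex). [cite: Balaban1983Higgs3, (1.22) p.416] -/
def va5 (nbar : ℕ) (hn2 : 2 ≤ nbar) (i j : Fin 2) : VLeg (g318a nbar hn2).kind := ⟨i, j⟩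

/-- The vertex `i` (`i = 0`: at the bond `b`, `i = 1`: at `b′`) of ⑤. [cite: Balaban1983Higgs3, (1.22) p.416] -/
def vx5 (nbar : ℕ) (hn2 : 2 ≤ nbar) (i : Fin 2) : Fin (g318a nbar hn2).nV := i

variable {hn2 : 2 ≤ nbar}

/-- every φ′-leg of ⑤ is one of the four `sa5 i j`. [cite: Balaban1983Higgs3, (1.22) p.416] -/
theorem sa5_cases : ∀ ℓ : SLeg (g318a nbar hn2).kind,
    ℓ = sa5 nbar hn2 0 0 ∨ ℓ = sa5 nbar hn2 0 1 ∨ ℓ = sa5 nbar hn2 1 0 ∨ ℓ = sa5 nbar hn2 1 1 := by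
  show ∀ ℓ : SLeg (g318a 2 le_rfl).kind, ℓ = sa5 2 le_rfl 0 0 ∨ ℓ = sa5 2 le_rfl 0 1 ∨ ℓ = sa5 2 le_rfl 1 0 ∨ ℓ = sa5 2 le_rfl 1 1
  decide

/-- every A′-leg of ⑤ is one of the four `va5 i j`. [cite: Balaban1983Higgs3, (1.22) p.416] -/
theorem va5_cases : ∀ ℓ : VLeg (g318a nbar hn2).kind,
    ℓ = va5 nbar hn2 0 0 ∨ ℓ = va5 nbar hn2 0 1 ∨ ℓ = va5 nbar hn2 1 0 ∨ ℓ = va5 nbar hn2 1 1 := by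
  show ∀ ℓ : VLeg (g318a 2 le_rfl).kind, ℓ = va5 2 le_rfl 0 0 ∨ ℓ = va5 2 le_rfl 0 1 ∨ ℓ = va5 2 le_rfl 1 0 ∨ ℓ = va5 2 le_rfl 1 1
  decide

/-- the four φ′-legs are distinct. [cite: Balaban1983Higgs3, (1.22) p.416] -/
theorem sa5_injective2 : ∀ i j i' j', sa5 nbar hn2 i j = sa5 nbar hn2 i' j' → i = i' ∧ j = j' := by
  show ∀ i j i' j', sa5 2 le_rfl i j = sa5 2 le_rfl i' j' → i = i' ∧ j = j'
  decide

/-- the four A′-legs are distinct. [cite: Balaban1983Higgs3, (1.22) p.416] -/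
theorem va5_injective2 : ∀ i j i' j', va5 nbar hn2 i j = va5 nbar hn2 i' j' → i = i' ∧ j = j' := by
  show ∀ i j i' j', va5 2 le_rfl i j = va5 2 le_rfl i' j' → i = i' ∧ j = j'
  decide

/-- **The φ′-line of ⑤**: the leg `0` of each vertex is joined to the leg `0` of the other. [cite: Balaban1983Higgs3, (1.22) p.416] -/
theorem sother5 (i : Fin 2) : (sPairing (g318a nbar hn2)).other (sa5 nbar hn2 i 0) = some (sa5 nbar hn2 i.rev 0) := by
  show spartner (g318a nbar hn2) (sa5 nbar hn2 i 0) = some (sa5 nbar hn2 i.rev 0)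
  refine (spartner_eq_some_iff _ _ _).2 ?_
  fin_cases i <;> rfl

/-- the leg `1` of each vertex of ⑤ is external. [cite: Balaban1983Higgs3, (1.22) p.416] -/
theorem sother5_ext (i : Fin 2) : (sPairing (g318a nbar hn2)).other (sa5 nbar hn2 i 1) = none := by
  show spartner (g318a nbar hn2) (sa5 nbar hn2 i 1) = none
  refine (spartner_eq_none_iff _ _).2 ?_
  fin_cases i <;> rfl

/-- a φ′-leg of ⑤ is external iff it is a leg `1`. [cite: Balaban1983Higgs3, (1.22) p.416] -/
theorem sother5_none_iff : ∀ ℓ : SLeg (g318a nbar hn2).kind,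
    (sPairing (g318a nbar hn2)).other ℓ = none ↔ ℓ = sa5 nbar hn2 0 1 ∨ ℓ = sa5 nbar hn2 1 1 := by
  show ∀ ℓ : SLeg (g318a 2 le_rfl).kind, (sPairing (g318a 2 le_rfl)).other ℓ = none ↔ ℓ = sa5 2 le_rfl 0 1 ∨ ℓ = sa5 2 le_rfl 1 1
  decide

/-- **The A′-lines of ⑤**: the A′-leg `j` of each vertex is joined to the A′-leg `j` of the other. [cite: Balaban1983Higgs3, (1.22) p.416] -/
theorem vother5 (i j : Fin 2) : (vPairing (g318a nbar hn2)).other (va5 nbar hn2 i j) = some (va5 nbar hn2 i.rev j) := by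
  show vpartner (g318a nbar hn2) (va5 nbar hn2 i j) = some (va5 nbar hn2 i.rev j)
  refine (vpartner_eq_some_iff _ _ _).2 ?_
  fin_cases i <;> fin_cases j <;> rfl

/-- the leg `0` of the vertex at `b` is the lower endpoint of the φ′-line, and the only one. [cite: Balaban1983Higgs3, (1.22) p.416] -/
theorem slower5_iff : ∀ ℓ : SLeg (g318a nbar hn2).kind, (sPairing (g318a nbar hn2)).isLower sRank ℓ = true ↔ ℓ = sa5 nbar hn2 0 0 := by
  show ∀ ℓ : SLeg (g318a 2 le_rfl).kind, (sPairing (g318a 2 le_rfl)).isLower sRank ℓ = true ↔ ℓ = sa5 2 le_rfl 0 0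
  decide

/-- the A′-legs of the vertex at `b` are the lower endpoints of the two A′-lines, and the only ones. [cite: Balaban1983Higgs3, (1.22) p.416] -/
theorem vlower5_iff : ∀ ℓ : VLeg (g318a nbar hn2).kind,
    (vPairing (g318a nbar hn2)).isLower vRank ℓ = true ↔ ℓ = va5 nbar hn2 0 0 ∨ ℓ = va5 nbar hn2 0 1 := by
  show ∀ ℓ : VLeg (g318a 2 le_rfl).kind,
    (vPairing (g318a 2 le_rfl)).isLower vRank ℓ = true ↔ ℓ = va5 2 le_rfl 0 0 ∨ ℓ = va5 2 le_rfl 0 1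
  decide

/-- The φ′-line of ⑤. [cite: Balaban1983Higgs3, (1.22) p.416] -/
def sl5 (nbar : ℕ) (hn2 : 2 ≤ nbar) : SLine (g318a nbar hn2) := ⟨sa5 nbar hn2 0 0, (slower5_iff _).2 rfl⟩

/-- it is the only φ′-line. [cite: Balaban1983Higgs3, (1.22) p.416] -/
instance uniqueSLine5 : Unique (SLine (g318a nbar hn2)) where
  default := sl5 nbar hn2
  uniq := fun l => Subtype.ext ((slower5_iff l.1).1 l.2)

/-- The A′-line of ⑤ through the A′-legs `0`. [cite: Balaban1983Higgs3, (1.22) p.416] -/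
def vl5a (nbar : ℕ) (hn2 : 2 ≤ nbar) : VLine (g318a nbar hn2) := ⟨va5 nbar hn2 0 0, (vlower5_iff _).2 (Or.inl rfl)⟩

/-- The A′-line of ⑤ through the A′-legs `1`. [cite: Balaban1983Higgs3, (1.22) p.416] -/
def vl5b (nbar : ℕ) (hn2 : 2 ≤ nbar) : VLine (g318a nbar hn2) := ⟨va5 nbar hn2 0 1, (vlower5_iff _).2 (Or.inr rfl)⟩

/-- the two A′-lines are distinct. [cite: Balaban1983Higgs3, (1.22) p.416] -/
theorem vl5a_ne_vl5b : vl5a nbar hn2 ≠ vl5b nbar hn2 := fun h => absurd (va5_injective2 0 0 0 1 (congrArg Subtype.val h)).2 (by decide)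

/-- the A′-lines of ⑤ are exactly `vl5a`, `vl5b`. [cite: Balaban1983Higgs3, (1.22) p.416] -/
theorem univ_vline5 : (univ : Finset (VLine (g318a nbar hn2))) = {vl5a nbar hn2, vl5b nbar hn2} := by
  ext l
  simp only [Finset.mem_univ, Finset.mem_insert, Finset.mem_singleton, true_iff]
  rcases (vlower5_iff l.1).1 l.2 with h | h
  · left; exact Subtype.ext h
  · right; exact Subtype.ext h

/-- the mates: `sa5 0 0 ↦ sa5 1 0`, `va5 0 j ↦ va5 1 j`. [cite: Balaban1983Higgs3, (1.22) p.416] -/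
theorem mate5 : (sPairing (g318a nbar hn2)).mate (sa5 nbar hn2 0 0) = sa5 nbar hn2 1 0 ∧
    (vPairing (g318a nbar hn2)).mate (va5 nbar hn2 0 0) = va5 nbar hn2 1 0 ∧
    (vPairing (g318a nbar hn2)).mate (va5 nbar hn2 0 1) = va5 nbar hn2 1 1 :=
  ⟨(sPairing (g318a nbar hn2)).mate_eq (sother5 0), (vPairing (g318a nbar hn2)).mate_eq (vother5 0 0),
    (vPairing (g318a nbar hn2)).mate_eq (vother5 0 1)⟩

/-- no A′-leg of ⑤ is external. [cite: Balaban1983Higgs3, (1.22) p.416] -/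
instance instIsEmptyExtVLeg5 : IsEmpty (ExtVLeg (g318a nbar hn2)) :=
  ⟨fun l => by
    have h := l.2
    rcases va5_cases l.1 with e | e | e | e <;> rw [e, vother5] at h <;> cases h⟩

/-- ⑤ has no averaging output. [cite: Balaban1983Higgs3, (1.22) p.416] -/
instance instIsEmptyOLeg5 : IsEmpty (OLeg (g318a nbar hn2).kind) := ⟨fun ℓ => Fin.elim0 (ℓ.2 : Fin 0)⟩

/-- The external φ′-leg of the vertex `i` of ⑤ (its leg `1`). [cite: Balaban1983Higgs3, (1.22) p.416] -/
def ee5 (nbar : ℕ) (hn2 : 2 ≤ nbar) (i : Fin 2) : ExtSLeg (g318a nbar hn2) := ⟨sa5 nbar hn2 i 1, sother5_ext i⟩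

/-- `ee5 0 ≠ ee5 1`. [cite: Balaban1983Higgs3, (1.22) p.416] -/
theorem ee5_0_ne_1 : ee5 nbar hn2 0 ≠ ee5 nbar hn2 1 := fun h => absurd (sa5_injective2 0 1 1 1 (congrArg Subtype.val h)).1 (by decide)

/-- the external φ′-legs of ⑤ are exactly `ee5 0`, `ee5 1`. [cite: Balaban1983Higgs3, (1.22) p.416] -/
theorem univ_extSLeg5 : (univ : Finset (ExtSLeg (g318a nbar hn2))) = {ee5 nbar hn2 0, ee5 nbar hn2 1} := by
  ext l
  simp only [Finset.mem_univ, Finset.mem_insert, Finset.mem_singleton, true_iff]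
  rcases (sother5_none_iff l.1).1 l.2 with h | h
  · left; exact Subtype.ext h
  · right; exact Subtype.ext h

end Legs5

/-! ## §8 ⑤ evaluated: `E = (e²/2)² Σ_{b,b′∈S} w₀(b)w₁(b′) η^{2d} g_k(b₋)²g_k(b′₋)² Kv₀(b,b′)Kv₁(b,b′) Σ_{a,c,a′,c′}(e_a·q²e_c)(e_{a′}·q²e_{c′}) Ks((b₋,a),(b′₋,a′)) Φ((b₋,c),(b′₋,c′))` -/

section Eval5

variable {P : HiggsLattice.Params} {N k : ℕ} {hn2 : 2 ≤ nbar}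

/-- The φ′-leg index assignment of ⑤ determined by the site deltas: at `x` the joined leg carries `a` and the external leg `c`, at `x′`
the joined leg `a′` and the external leg `c′` (`q = ((a,c),(a′,c′))`). [cite: Balaban1983Higgs3, (1.22) p.416] -/
def assign5 (x x' : HiggsLattice.Site P 0) (q : (Fin N × Fin N) × (Fin N × Fin N)) :
    SLeg (g318a nbar hn2).kind → HiggsLattice.Site P 0 × Fin N :=
  fun ℓ => if ℓ.1.val = 0 then (x, if ℓ.2.val = 0 then q.1.1 else q.1.2) else (x', if ℓ.2.val = 0 then q.2.1 else q.2.2)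

/-- the values of `assign5` on the four legs. [cite: Balaban1983Higgs3, (1.22) p.416] -/
theorem assign5_apply (x x' : HiggsLattice.Site P 0) (q : (Fin N × Fin N) × (Fin N × Fin N)) :
    assign5 (hn2 := hn2) x x' q (sa5 nbar hn2 0 0) = (x, q.1.1) ∧ assign5 (hn2 := hn2) x x' q (sa5 nbar hn2 0 1) = (x, q.1.2) ∧
    assign5 (hn2 := hn2) x x' q (sa5 nbar hn2 1 0) = (x', q.2.1) ∧ assign5 (hn2 := hn2) x x' q (sa5 nbar hn2 1 1) = (x', q.2.2) := by
  have t0 : ((0 : Fin 2) : ℕ) = 0 := by decide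
  have t1 : ¬((1 : Fin 2) : ℕ) = 0 := by decide
  refine ⟨?_, ?_, ?_, ?_⟩
  · show (if ((0 : Fin 2) : ℕ) = 0 then (x, if ((0 : Fin 2) : ℕ) = 0 then q.1.1 else q.1.2)
        else (x', if ((0 : Fin 2) : ℕ) = 0 then q.2.1 else q.2.2)) = _
    rw [if_pos t0, if_pos t0]
  · show (if ((0 : Fin 2) : ℕ) = 0 then (x, if ((1 : Fin 2) : ℕ) = 0 then q.1.1 else q.1.2)
        else (x', if ((1 : Fin 2) : ℕ) = 0 then q.2.1 else q.2.2)) = _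
    rw [if_pos t0, if_neg t1]
  · show (if ((1 : Fin 2) : ℕ) = 0 then (x, if ((0 : Fin 2) : ℕ) = 0 then q.1.1 else q.1.2)
        else (x', if ((0 : Fin 2) : ℕ) = 0 then q.2.1 else q.2.2)) = _
    rw [if_neg t1, if_pos t0]
  · show (if ((1 : Fin 2) : ℕ) = 0 then (x, if ((1 : Fin 2) : ℕ) = 0 then q.1.1 else q.1.2)
        else (x', if ((1 : Fin 2) : ℕ) = 0 then q.2.1 else q.2.2)) = _
    rw [if_neg t1, if_neg t1]

/-- `assign5 x x′` is injective. [cite: Balaban1983Higgs3, (1.22) p.416] -/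
theorem assign5_injective (x x' : HiggsLattice.Site P 0) : Function.Injective (assign5 (hn2 := hn2) (N := N) x x') := by
  rintro ⟨⟨a, c⟩, ⟨a', c'⟩⟩ ⟨⟨b, d⟩, ⟨b', d'⟩⟩ h
  obtain ⟨e00, e01, e10, e11⟩ := assign5_apply (hn2 := hn2) x x' ((a, c), (a', c'))
  obtain ⟨f00, f01, f10, f11⟩ := assign5_apply (hn2 := hn2) x x' ((b, d), (b', d'))
  have h00 := congrFun h (sa5 nbar hn2 0 0)
  have h01 := congrFun h (sa5 nbar hn2 0 1)
  have h10 := congrFun h (sa5 nbar hn2 1 0)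
  have h11 := congrFun h (sa5 nbar hn2 1 1)
  rw [e00, f00] at h00
  rw [e01, f01] at h01
  rw [e10, f10] at h10
  rw [e11, f11] at h11
  simp only [Prod.mk.injEq, true_and] at h00 h01 h10 h11
  rw [h00, h01, h10, h11]

/-- The external legs of ⑤ at `(x, c)`, `(x′, c′)`. [cite: Balaban1983Higgs3, (1.22) p.416] -/
def extAt5 (x x' : HiggsLattice.Site P 0) (c c' : Fin N) : ExtSLeg (g318a nbar hn2) → HiggsLattice.Site P 0 × Fin N :=
  fun ℓ => if ℓ = ee5 nbar hn2 0 then (x, c) else (x', c')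

/-- on `assign5 x x′ ((a,c),(a′,c′))` the external legs sit at `(x, c)`, `(x′, c′)`. [cite: Balaban1983Higgs3, (1.22) p.416] -/
theorem assign5_ext (x x' : HiggsLattice.Site P 0) (q : (Fin N × Fin N) × (Fin N × Fin N)) :
    (fun ℓ : ExtSLeg (g318a nbar hn2) => assign5 x x' q ℓ.1) = extAt5 x x' q.1.2 q.2.2 := by
  obtain ⟨-, e01, -, e11⟩ := assign5_apply (hn2 := hn2) x x' q
  funext ℓ
  unfold extAt5
  rcases (sother5_none_iff ℓ.1).1 ℓ.2 with h | h
  · rw [h, e01, if_pos (Subtype.ext h)]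
  · rw [h, e11, if_neg (fun h' => absurd (h.symm.trans (congrArg Subtype.val h'))
      (fun e => absurd (sa5_injective2 1 1 0 1 e).1 (by decide)))]

/-- kernel: the Kronecker sum over the φ′-leg assignments of ⑤ — the site deltas of the two (1.10) brackets put both legs of the
vertex at `b` at the site `x = b₋` and both legs of the vertex at `b′` at `x′ = b′₋`, with free internal indices. [folklore] -/
private theorem sdelta_sum5 (x x' : HiggsLattice.Site P 0) (F : (SLeg (g318a nbar hn2).kind → HiggsLattice.Site P 0 × Fin N) → ℝ) :
    ∑ α : SLeg (g318a nbar hn2).kind → HiggsLattice.Site P 0 × Fin N,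
        ((if x = (α (sa5 nbar hn2 0 0)).1 ∧ x = (α (sa5 nbar hn2 0 1)).1 then (1 : ℝ) else 0) *
          (if x' = (α (sa5 nbar hn2 1 0)).1 ∧ x' = (α (sa5 nbar hn2 1 1)).1 then (1 : ℝ) else 0)) * F α =
      ∑ a : Fin N, ∑ c : Fin N, ∑ a' : Fin N, ∑ c' : Fin N, F (assign5 x x' ((a, c), (a', c'))) := by
  classical
  set S : Finset (SLeg (g318a nbar hn2).kind → HiggsLattice.Site P 0 × Fin N) := univ.image (assign5 x x') with hS
  rw [← Finset.sum_subset (Finset.subset_univ S)]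
  · rw [hS, Finset.sum_image fun q _ q' _ h => assign5_injective x x' h]
    have hterm : ∀ q : (Fin N × Fin N) × (Fin N × Fin N),
        ((if x = (assign5 (hn2 := hn2) x x' q (sa5 nbar hn2 0 0)).1 ∧ x = (assign5 (hn2 := hn2) x x' q (sa5 nbar hn2 0 1)).1
            then (1 : ℝ) else 0) *
          (if x' = (assign5 (hn2 := hn2) x x' q (sa5 nbar hn2 1 0)).1 ∧ x' = (assign5 (hn2 := hn2) x x' q (sa5 nbar hn2 1 1)).1
            then (1 : ℝ) else 0)) * F (assign5 x x' q) = F (assign5 x x' q) := by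
      intro q
      obtain ⟨e00, e01, e10, e11⟩ := assign5_apply (hn2 := hn2) x x' q
      rw [e00, e01, e10, e11]
      simp
    simp only [hterm]
    rw [Fintype.sum_prod_type, Fintype.sum_prod_type]
    simp only [Fintype.sum_prod_type]
  · intro α _ hα
    by_cases h0 : x = (α (sa5 nbar hn2 0 0)).1 ∧ x = (α (sa5 nbar hn2 0 1)).1
    · by_cases h1 : x' = (α (sa5 nbar hn2 1 0)).1 ∧ x' = (α (sa5 nbar hn2 1 1)).1
      · exfalso
        apply hα
        rw [hS, Finset.mem_image]
        refine ⟨(((α (sa5 nbar hn2 0 0)).2, (α (sa5 nbar hn2 0 1)).2), ((α (sa5 nbar hn2 1 0)).2, (α (sa5 nbar hn2 1 1)).2)),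
          Finset.mem_univ _, ?_⟩
        obtain ⟨e00, e01, e10, e11⟩ :=
          assign5_apply (hn2 := hn2) x x' (((α (sa5 nbar hn2 0 0)).2, (α (sa5 nbar hn2 0 1)).2), ((α (sa5 nbar hn2 1 0)).2, (α (sa5 nbar hn2 1 1)).2))
        funext ℓ
        rcases sa5_cases ℓ with h | h | h | h <;> rw [h]
        · rw [e00]; exact Prod.ext h0.1 rfl
        · rw [e01]; exact Prod.ext h0.2 rfl
        · rw [e10]; exact Prod.ext h1.1 rfl
        · rw [e11]; exact Prod.ext h1.2 rfl
      · rw [if_neg h1]; ring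
    · rw [if_neg h0]; ring

/-- The A′-leg index assignment of ⑤ determined by the bond deltas: both A′-legs of the vertex `0` at `b`, both of the vertex `1` at
`b′`. [cite: Balaban1983Higgs3, (1.22) p.416] -/
def bassign5 (b b' : HiggsLattice.PBond P 0) : VLeg (g318a nbar hn2).kind → HiggsLattice.PBond P 0 :=
  fun ℓ => if ℓ.1.val = 0 then b else b'

/-- the values of `bassign5`. [cite: Balaban1983Higgs3, (1.22) p.416] -/
theorem bassign5_apply (b b' : HiggsLattice.PBond P 0) (j : Fin 2) :
    bassign5 (hn2 := hn2) b b' (va5 nbar hn2 0 j) = b ∧ bassign5 (hn2 := hn2) b b' (va5 nbar hn2 1 j) = b' := by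
  have t0 : ((0 : Fin 2) : ℕ) = 0 := by decide
  have t1 : ¬((1 : Fin 2) : ℕ) = 0 := by decide
  exact ⟨if_pos t0, if_neg t1⟩

/-- kernel: the Kronecker sum over the A′-leg assignments of ⑤. [folklore] -/
private theorem vdelta_sum5 [DecidableEq (HiggsLattice.PBond P 0)] (b b' : HiggsLattice.PBond P 0)
    (F : (VLeg (g318a nbar hn2).kind → HiggsLattice.PBond P 0) → ℝ) :
    ∑ β : VLeg (g318a nbar hn2).kind → HiggsLattice.PBond P 0,
        ((if b = β (va5 nbar hn2 0 0) ∧ b = β (va5 nbar hn2 0 1) then (1 : ℝ) else 0) *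
          (if b' = β (va5 nbar hn2 1 0) ∧ b' = β (va5 nbar hn2 1 1) then (1 : ℝ) else 0)) * F β = F (bassign5 b b') := by
  classical
  obtain ⟨e00, e10⟩ := bassign5_apply (hn2 := hn2) b b' 0
  obtain ⟨e01, e11⟩ := bassign5_apply (hn2 := hn2) b b' 1
  rw [Finset.sum_eq_single (bassign5 b b')]
  · rw [e00, e01, e10, e11]
    simp
  · intro β _ hβ
    by_cases h0 : b = β (va5 nbar hn2 0 0) ∧ b = β (va5 nbar hn2 0 1)
    · by_cases h1 : b' = β (va5 nbar hn2 1 0) ∧ b' = β (va5 nbar hn2 1 1)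
      · exfalso
        apply hβ
        funext ℓ
        rcases va5_cases ℓ with e | e | e | e <;> rw [e]
        · rw [e00]; exact h0.1.symm
        · rw [e01]; exact h0.2.symm
        · rw [e10]; exact h1.1.symm
        · rw [e11]; exact h1.2.symm
      · rw [if_neg h1]; ring
    · rw [if_neg h0]; ring
  · intro h
    exact absurd (Finset.mem_univ _) h

/-- A PRODUCT external field of ⑤ at the contributing assignments: `φ(x)_c · φ′(x′)_{c′}`. [cite: Balaban1983Higgs3, p.419] -/
theorem extS_extAt5 (φ : ExtSLeg (g318a nbar hn2) → HiggsLattice.ScalarField P 0 N) (x x' : HiggsLattice.Site P 0) (c c' : Fin N) :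
    extS (g318a nbar hn2) φ (extAt5 x x' c c') = φ (ee5 nbar hn2 0) x c * φ (ee5 nbar hn2 1) x' c' := by
  unfold extS
  rw [show (∏ ℓ : ExtSLeg (g318a nbar hn2), φ ℓ (extAt5 x x' c c' ℓ).1 (extAt5 x x' c c' ℓ).2) =
      ∏ ℓ ∈ ({ee5 nbar hn2 0, ee5 nbar hn2 1} : Finset _), φ ℓ (extAt5 x x' c c' ℓ).1 (extAt5 x x' c c' ℓ).2 by rw [← univ_extSLeg5],
    Finset.prod_pair ee5_0_ne_1]
  unfold extAt5
  rw [if_pos rfl, if_neg (Ne.symm ee5_0_ne_1)]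

variable [DecidableEq (HiggsLattice.PBond P 0)]

/-- The polarized A′-legs of (1.10)_{2,0} on basis bond fields: `Π_{j<2} g(b₋)δ_{c_j}(b) = [b = c₀][b = c₁]·g(b₋)²` (FILE 3's
`vlegs_basisV` for an arbitrary pair of bonds). [cite: Balaban1983Higgs3, (1.10) p.413] -/
theorem vlegs_basisV_two (g : HiggsLattice.Site P 0 → ℝ) (c : Fin 2 → HiggsLattice.PBond P 0) (b : HiggsLattice.PBond P 0) :
    vlegs g (fun j => basisV (c j)) b = (if b = c 0 ∧ b = c 1 then (1 : ℝ) else 0) * g b.src ^ 2 := by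
  unfold vlegs basisV
  rw [Fin.prod_univ_two]
  by_cases h0 : b = c 0 <;> by_cases h1 : b = c 1 <;> simp [h0, h1] <;> ring

/-- **The evaluator EVALUATED on the picture ⑤ of (1.22) (= (3.18)₁: two vertices (1.10)_{2,0} joined by one φ′-line and both A′-lines)**:
for the model data `M`, the localization weights `w₀`, `w₁` (one per vertex, on bonds), any scalar line kernel `Ks`, any two vector line
kernels `Kv`, and any joint external scalar field `Φ`, the expression of p18's graph `g318a` is
`E = (e²/2)² Σ_{b,b′∈S} w₀(b)w₁(b′) η^{2d} g_k(b₋)²g_k(b′₋)² · Kv₀(b,b′)Kv₁(b,b′) · Σ_{a,c,a′,c′} (e_a·q²e_c)(e_{a′}·q²e_{c′})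
Ks((b₋,a),(b′₋,a′)) Φ((b₋,c),(b′₋,c′))` — each vertex's pair of A′-legs replaced by the two A-line covariances between the two bonds,
the φ′-line between the `q²`-brackets of the two vertices. [cite: Balaban1983Higgs3, (1.22) p.416] [cite: Balaban1983Higgs3, (3.18) p.438] -/
theorem graphAmp_g318a (M : Model P N k) (dm2 : Fin (g318a nbar hn2).nV → HiggsLattice.Site P 0 → ℝ)
    (loc : Fin (g318a nbar hn2).nV → Loc P k) (Po : OutPairing (g318a nbar hn2))
    (Ks : SLine (g318a nbar hn2) → HiggsLattice.Site P 0 × Fin N → HiggsLattice.Site P 0 × Fin N → ℝ)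
    (Kv : VLine (g318a nbar hn2) → HiggsLattice.PBond P 0 → HiggsLattice.PBond P 0 → ℝ)
    (Ko : Po.Line oRank → HiggsLattice.Site P k × Fin N → HiggsLattice.Site P k × Fin N → ℝ)
    (Φ : (ExtSLeg (g318a nbar hn2) → HiggsLattice.Site P 0 × Fin N) → ℝ) :
    graphAmp (g318a nbar hn2) M dm2 loc Po Ks Kv Ko Φ (fun _ => 1) (fun _ => 1) =
      (M.C.e ^ 2 / 2) ^ 2 * ∑ b ∈ M.S, ∑ b' ∈ M.S, (loc (vx5 nbar hn2 0)).wB b * (loc (vx5 nbar hn2 1)).wB b' *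
        ((P.mesh 0 ^ P.d) ^ 2 * (M.g b.src ^ 2 * M.g b'.src ^ 2) * (Kv (vl5a nbar hn2) b b' * Kv (vl5b nbar hn2) b b') *
          ∑ a : Fin N, ∑ c : Fin N, ∑ a' : Fin N, ∑ c' : Fin N,
            opCoeff (M.C.q ^ 2) a c * opCoeff (M.C.q ^ 2) a' c' * Ks (sl5 nbar hn2) (b.src, a) (b'.src, a') *
              Φ (extAt5 b.src b'.src c c')) := by
  haveI : IsEmpty (Po.Line oRank) := ⟨fun l => IsEmpty.false l.1⟩
  have hV : ∀ (α : SLeg (g318a nbar hn2).kind → HiggsLattice.Site P 0 × Fin N)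
      (β : VLeg (g318a nbar hn2).kind → HiggsLattice.PBond P 0) (ο : OLeg (g318a nbar hn2).kind → HiggsLattice.Site P k × Fin N),
      vertexFactor (rulesOf (g318a nbar hn2) M dm2 loc) basisE basisV basisE α β ο =
        rule110 M.C M.g M.At 2 0 M.S (loc (vx5 nbar hn2 0)).wB (fun j => basisE (α (sa5 nbar hn2 0 j)))
            (fun j => basisV (β (va5 nbar hn2 0 j))) *
          rule110 M.C M.g M.At 2 0 M.S (loc (vx5 nbar hn2 1)).wB (fun j => basisE (α (sa5 nbar hn2 1 j)))
            (fun j => basisV (β (va5 nbar hn2 1 j))) := by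
    intro α β ο
    unfold vertexFactor
    exact Fin.prod_univ_two _
  have hs : ∀ α : SLeg (g318a nbar hn2).kind → HiggsLattice.Site P 0 × Fin N,
      sLineFactor Ks α = Ks (sl5 nbar hn2) (α (sa5 nbar hn2 0 0)) (α (sa5 nbar hn2 1 0)) := by
    intro α
    unfold sLineFactor
    rw [Fintype.prod_unique]
    show Ks (sl5 nbar hn2) (α (sa5 nbar hn2 0 0)) (α ((sPairing (g318a nbar hn2)).mate (sa5 nbar hn2 0 0))) = _
    rw [mate5.1]
  have hv : ∀ β : VLeg (g318a nbar hn2).kind → HiggsLattice.PBond P 0,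
      vLineFactor Kv β = Kv (vl5a nbar hn2) (β (va5 nbar hn2 0 0)) (β (va5 nbar hn2 1 0)) *
        Kv (vl5b nbar hn2) (β (va5 nbar hn2 0 1)) (β (va5 nbar hn2 1 1)) := by
    intro β
    unfold vLineFactor
    rw [show (∏ l : VLine (g318a nbar hn2), Kv l (β l.1) (β ((vPairing (g318a nbar hn2)).mate l.1))) =
        ∏ l ∈ ({vl5a nbar hn2, vl5b nbar hn2} : Finset _), Kv l (β l.1) (β ((vPairing (g318a nbar hn2)).mate l.1)) by
          rw [← univ_vline5], Finset.prod_pair vl5a_ne_vl5b]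
    show Kv (vl5a nbar hn2) (β (va5 nbar hn2 0 0)) (β ((vPairing (g318a nbar hn2)).mate (va5 nbar hn2 0 0))) *
        Kv (vl5b nbar hn2) (β (va5 nbar hn2 0 1)) (β ((vPairing (g318a nbar hn2)).mate (va5 nbar hn2 0 1))) = _
    rw [mate5.2.1, mate5.2.2]
  have ho : ∀ ο : OLeg (g318a nbar hn2).kind → HiggsLattice.Site P k × Fin N, oLineFactor Po Ko ο = 1 := by
    intro ο
    unfold oLineFactor
    exact Fintype.prod_empty _
  -- the (1.10)_{2,0} rule on basis fields, at each vertex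
  have hrule : ∀ (i : Fin 2) (α : SLeg (g318a nbar hn2).kind → HiggsLattice.Site P 0 × Fin N)
      (β : VLeg (g318a nbar hn2).kind → HiggsLattice.PBond P 0),
      rule110 M.C M.g M.At 2 0 M.S (loc (vx5 nbar hn2 i)).wB (fun j => basisE (α (sa5 nbar hn2 i j)))
          (fun j => basisV (β (va5 nbar hn2 i j))) =
        ∑ b ∈ M.S, (M.C.e ^ 2 / 2 * ((loc (vx5 nbar hn2 i)).wB b * P.mesh 0 ^ P.d)) *
          (((if b.src = (α (sa5 nbar hn2 i 0)).1 ∧ b.src = (α (sa5 nbar hn2 i 1)).1 then (1 : ℝ) else 0) *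
              opCoeff (M.C.q ^ 2) (α (sa5 nbar hn2 i 0)).2 (α (sa5 nbar hn2 i 1)).2) *
            ((if b = β (va5 nbar hn2 i 0) ∧ b = β (va5 nbar hn2 i 1) then (1 : ℝ) else 0) * M.g b.src ^ 2)) := by
    intro i α β
    unfold rule110
    simp only [pleg110_basisE, vlegs_basisV_two, pow_zero, mul_one, add_zero]
    rw [Finset.mul_sum]
    refine Finset.sum_congr rfl fun b _ => ?_
    have h2 : ((Nat.factorial 2 : ℕ) : ℝ) = 2 := by norm_num [Nat.factorial]
    have h0 : ((Nat.factorial 0 : ℕ) : ℝ) = 1 := by norm_num [Nat.factorial]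
    have hz : P.mesh 0 ^ (((2 : ℕ) : ℤ) + ((0 : ℕ) : ℤ) - 2) = 1 := by
      rw [show (((2 : ℕ) : ℤ) + ((0 : ℕ) : ℤ) - 2) = 0 by norm_num, zpow_zero]
    rw [h2, h0, hz]
    ring
  unfold graphAmp amp
  simp only [Fintype.sum_unique, hV, hs, hv, ho, mul_one, hrule]
  -- abbreviations
  set DS : Fin 2 → (SLeg (g318a nbar hn2).kind → HiggsLattice.Site P 0 × Fin N) → HiggsLattice.PBond P 0 → ℝ := fun i α b =>
    (if b.src = (α (sa5 nbar hn2 i 0)).1 ∧ b.src = (α (sa5 nbar hn2 i 1)).1 then (1 : ℝ) else 0) with hDS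
  set DV : Fin 2 → (VLeg (g318a nbar hn2).kind → HiggsLattice.PBond P 0) → HiggsLattice.PBond P 0 → ℝ := fun i β b =>
    (if b = β (va5 nbar hn2 i 0) ∧ b = β (va5 nbar hn2 i 1) then (1 : ℝ) else 0) with hDV
  set LS : (SLeg (g318a nbar hn2).kind → HiggsLattice.Site P 0 × Fin N) → ℝ := fun α =>
    opCoeff (M.C.q ^ 2) (α (sa5 nbar hn2 0 0)).2 (α (sa5 nbar hn2 0 1)).2 * opCoeff (M.C.q ^ 2) (α (sa5 nbar hn2 1 0)).2 (α (sa5 nbar hn2 1 1)).2 *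
      Ks (sl5 nbar hn2) (α (sa5 nbar hn2 0 0)) (α (sa5 nbar hn2 1 0)) * Φ (fun ℓ => α ℓ.1) with hLS
  set LV : (VLeg (g318a nbar hn2).kind → HiggsLattice.PBond P 0) → ℝ := fun β =>
    Kv (vl5a nbar hn2) (β (va5 nbar hn2 0 0)) (β (va5 nbar hn2 1 0)) * Kv (vl5b nbar hn2) (β (va5 nbar hn2 0 1)) (β (va5 nbar hn2 1 1))
    with hLV
  set Cst : HiggsLattice.PBond P 0 → HiggsLattice.PBond P 0 → ℝ := fun b b' =>
    (M.C.e ^ 2 / 2) ^ 2 * ((loc (vx5 nbar hn2 0)).wB b * (loc (vx5 nbar hn2 1)).wB b' *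
      ((P.mesh 0 ^ P.d) ^ 2 * (M.g b.src ^ 2 * M.g b'.src ^ 2))) with hCst
  -- step 1: multiply out the two vertex sums
  have h1 : ∀ (α : SLeg (g318a nbar hn2).kind → HiggsLattice.Site P 0 × Fin N) (β : VLeg (g318a nbar hn2).kind → HiggsLattice.PBond P 0),
      (∑ b ∈ M.S, (M.C.e ^ 2 / 2 * ((loc (vx5 nbar hn2 0)).wB b * P.mesh 0 ^ P.d)) *
          ((DS 0 α b * opCoeff (M.C.q ^ 2) (α (sa5 nbar hn2 0 0)).2 (α (sa5 nbar hn2 0 1)).2) * (DV 0 β b * M.g b.src ^ 2))) *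
        (∑ b' ∈ M.S, (M.C.e ^ 2 / 2 * ((loc (vx5 nbar hn2 1)).wB b' * P.mesh 0 ^ P.d)) *
          ((DS 1 α b' * opCoeff (M.C.q ^ 2) (α (sa5 nbar hn2 1 0)).2 (α (sa5 nbar hn2 1 1)).2) * (DV 1 β b' * M.g b'.src ^ 2))) *
        Φ (fun ℓ => α ℓ.1) *
        (Ks (sl5 nbar hn2) (α (sa5 nbar hn2 0 0)) (α (sa5 nbar hn2 1 0)) *
          (Kv (vl5a nbar hn2) (β (va5 nbar hn2 0 0)) (β (va5 nbar hn2 1 0)) * Kv (vl5b nbar hn2) (β (va5 nbar hn2 0 1)) (β (va5 nbar hn2 1 1)))) =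
      ∑ b ∈ M.S, ∑ b' ∈ M.S, Cst b b' * ((DS 0 α b * DS 1 α b') * LS α * ((DV 0 β b * DV 1 β b') * LV β)) := by
    intro α β
    rw [Finset.sum_mul_sum, Finset.sum_mul, Finset.sum_mul]
    refine Finset.sum_congr rfl fun b _ => ?_
    rw [Finset.sum_mul, Finset.sum_mul]
    refine Finset.sum_congr rfl fun b' _ => ?_
    rw [hLS, hLV, hCst]
    ring
  rw [Finset.sum_congr rfl fun α _ => Finset.sum_congr rfl fun β _ => h1 α β]
  -- step 2: the A′-leg sum collapses onto `bassign5 b b′`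
  have h2 : ∀ α : SLeg (g318a nbar hn2).kind → HiggsLattice.Site P 0 × Fin N,
      ∑ β : VLeg (g318a nbar hn2).kind → HiggsLattice.PBond P 0, ∑ b ∈ M.S, ∑ b' ∈ M.S,
          Cst b b' * ((DS 0 α b * DS 1 α b') * LS α * ((DV 0 β b * DV 1 β b') * LV β)) =
        ∑ b ∈ M.S, ∑ b' ∈ M.S, Cst b b' * ((DS 0 α b * DS 1 α b') * LS α * LV (bassign5 b b')) := by
    intro α
    rw [Finset.sum_comm]
    refine Finset.sum_congr rfl fun b _ => ?_
    rw [Finset.sum_comm]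
    refine Finset.sum_congr rfl fun b' _ => ?_
    rw [← Finset.mul_sum, ← Finset.mul_sum]
    congr 2
    have h := vdelta_sum5 (hn2 := hn2) b b' LV
    simp only [hDV] at h ⊢
    exact h
  rw [Finset.sum_congr rfl fun α _ => h2 α]
  -- step 3: the φ′-leg sum collapses onto the assignments `assign5 b₋ b′₋ ((a,c),(a′,c′))`
  rw [Finset.sum_comm]
  rw [Finset.mul_sum]
  refine Finset.sum_congr rfl fun b _ => ?_
  rw [Finset.sum_comm, Finset.mul_sum]
  refine Finset.sum_congr rfl fun b' _ => ?_
  have h3 : ∀ α : SLeg (g318a nbar hn2).kind → HiggsLattice.Site P 0 × Fin N,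
      Cst b b' * ((DS 0 α b * DS 1 α b') * LS α * LV (bassign5 b b')) =
        (Cst b b' * LV (bassign5 b b')) * ((DS 0 α b * DS 1 α b') * LS α) := by
    intro α
    ring
  rw [Finset.sum_congr rfl fun α _ => h3 α, ← Finset.mul_sum]
  have h4 := sdelta_sum5 (hn2 := hn2) b.src b'.src LS
  simp only [hDS] at h4 ⊢
  rw [h4]
  simp only [hLS, hLV, hCst, assign5_ext]
  obtain ⟨e00, e10⟩ := bassign5_apply (hn2 := hn2) b b' 0
  obtain ⟨e01, e11⟩ := bassign5_apply (hn2 := hn2) b b' 1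
  obtain h5 := fun q : (Fin N × Fin N) × (Fin N × Fin N) => assign5_apply (hn2 := hn2) b.src b'.src q
  simp only [e00, e10, e01, e11, (h5 _).1, (h5 _).2.1, (h5 _).2.2.1, (h5 _).2.2.2]
  ring

end Eval5

/-! ## §9 ⑤ for product external fields and at print's data: the fifth term of (1.22) -/

section Free5

variable {P : HiggsLattice.Params} {N k : ℕ} {hn2 : 2 ≤ nbar}

/-- kernel: a sum over the positively oriented bonds is the sum over initial points and directions. [folklore] -/
private theorem sum_bond5 {j : ℕ} (F : HiggsLattice.PBond P j → ℝ) :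
    ∑ b, F b = ∑ x : HiggsLattice.Site P j, ∑ μ : Fin P.d, F ⟨x, μ⟩ := by
  let e : HiggsLattice.Site P j × Fin P.d ≃ HiggsLattice.PBond P j :=
    ⟨fun p => ⟨p.1, p.2⟩, fun b => (b.src, b.dir), fun _ => rfl, fun _ => rfl⟩
  rw [← Fintype.sum_equiv e (fun p => F ⟨p.1, p.2⟩) F fun _ => rfl, Fintype.sum_prod_type]

/-- kernel: the scalar product of `W = ℝ^N` in coordinates. [folklore] -/
private theorem inner_eq_sum_coord5 (u v : HiggsCovariance.E N) : ⟪u, v⟫_ℝ = ∑ a, u a * v a := by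
  rw [PiLp.inner_apply]
  simp [mul_comm]

/-- kernel: a vector of `W = ℝ^N` is the sum of its components times the basis vectors. [folklore] -/
private theorem sum_smul_single5 (u : HiggsCovariance.E N) : ∑ a : Fin N, u a • EuclideanSpace.single a (1 : ℝ) = u := by
  ext i
  simp [Finset.sum_apply, Pi.single_apply]

/-- The matrix entry `e_a·Te_c` is the `a`-th component of `Te_c`. [cite: Balaban1983Higgs3, (1.10) p.413] -/
theorem opCoeff_eq_apply (T : B3Eq18VertexExpansion.Op N) (a c : Fin N) : opCoeff T a c = (T (EuclideanSpace.single c (1 : ℝ))) a := by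
  unfold opCoeff
  rw [EuclideanSpace.inner_single_left]
  simp

/-- Contracting the matrix entries of `T` against the components of `u` gives the components of `Tu`: `Σ_c (e_a·Te_c)u_c = (Tu)_a`.
[cite: Balaban1983Higgs3, (1.10) p.413] -/
theorem sum_opCoeff_mul (T : B3Eq18VertexExpansion.Op N) (a : Fin N) (u : HiggsCovariance.E N) :
    ∑ c : Fin N, opCoeff T a c * u c = (T u) a := by
  conv_rhs => rw [← sum_smul_single5 u, map_sum]
  rw [WithLp.ofLp_sum, Finset.sum_apply]
  refine Finset.sum_congr rfl fun c _ => ?_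
  rw [opCoeff_eq_apply, map_smul, WithLp.ofLp_smul, Pi.smul_apply, smul_eq_mul, mul_comm]

/-- kernel: the index sums of ⑤ with the free scalar propagator on the φ′-line — the two `q²`-brackets contracted through
`[a = a′]C₀`: `Σ_{a,c,a′,c′} (e_a·Te_c)(e_{a′}·Te_{c′})[a = a′]C·u_c v_{c′} = C·(Tu·Tv)`. [folklore] -/
private theorem loop_sum5 (T : B3Eq18VertexExpansion.Op N) (C : ℝ) (u v : HiggsCovariance.E N) :
    ∑ a : Fin N, ∑ c : Fin N, ∑ a' : Fin N, ∑ c' : Fin N,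
        opCoeff T a c * opCoeff T a' c' * (if a = a' then C else 0) * (u c * v c') = C * ⟪T u, T v⟫_ℝ := by
  have h1 : ∀ a c a' : Fin N, ∑ c' : Fin N, opCoeff T a c * opCoeff T a' c' * (if a = a' then C else 0) * (u c * v c') =
      opCoeff T a c * u c * (if a = a' then C else 0) * (T v) a' := by
    intro a c a'
    rw [← sum_opCoeff_mul T a' v, Finset.mul_sum]
    exact Finset.sum_congr rfl fun c' _ => by ring
  have h2 : ∀ a c : Fin N, ∑ a' : Fin N, opCoeff T a c * u c * (if a = a' then C else 0) * (T v) a' =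
      opCoeff T a c * u c * (C * (T v) a) := by
    intro a c
    have h3 : ∀ a' : Fin N, opCoeff T a c * u c * (if a = a' then C else 0) * (T v) a' =
        if a = a' then opCoeff T a c * u c * (C * (T v) a') else 0 := by
      intro a'
      split_ifs <;> ring
    rw [Finset.sum_congr rfl fun a' _ => h3 a', Finset.sum_ite_eq]
    simp
  have h4 : ∀ a : Fin N, ∑ c : Fin N, opCoeff T a c * u c * (C * (T v) a) = (T u) a * (C * (T v) a) := by
    intro a
    rw [← Finset.sum_mul, sum_opCoeff_mul]
  simp only [h1, h2, h4]
  rw [inner_eq_sum_coord5, Finset.mul_sum]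
  exact Finset.sum_congr rfl fun a _ => by ring

/-- kernel: `q u·q v = −u·q²v` (`q` antisymmetric, `q_skew`). [cite: Balaban1982Higgs1, (1.7) p.605] -/
private theorem inner_q_q5 (C : HiggsLattice.ChargeData N) (u v : HiggsCovariance.E N) : ⟪C.q u, C.q v⟫_ℝ = -⟪u, C.q (C.q v)⟫_ℝ := by
  have h : ⟪C.q u, C.q v⟫_ℝ = ⟪u, (star C.q) (C.q v)⟫_ℝ := by
    rw [ContinuousLinearMap.star_eq_adjoint, ContinuousLinearMap.adjoint_inner_right]
  have h2 : (-C.q) (C.q v) = -(C.q (C.q v)) := rfl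
  rw [h, C.q_skew, h2, inner_neg_right]

/-- `q²u·q²v = u·q⁴v`: the two `q²`-brackets of ⑤ joined by the φ′-line combine into print's `q²…q²` (`q` antisymmetric ⇒ `q²`
symmetric). [cite: Balaban1983Higgs3, (1.22) p.416] -/
theorem inner_sq_sq (C : HiggsLattice.ChargeData N) (u v : HiggsCovariance.E N) : ⟪(C.q ^ 2) u, (C.q ^ 2) v⟫_ℝ = ⟪u, (C.q ^ 4) v⟫_ℝ := by
  have e2 : ∀ w, (C.q ^ 2) w = C.q (C.q w) := fun w => by rw [sq]; rfl
  have e4 : (C.q ^ 4) v = C.q (C.q (C.q (C.q v))) := by rw [show (4 : ℕ) = 2 + 2 from rfl, pow_add, sq]; rfl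
  rw [e2, e2, e4, inner_q_q5, inner_q_q5, neg_neg]

/-- The two external fields of ⑤: `φ` on the external leg of the vertex at `b`, `φ′` on the one at `b′`. [cite: Balaban1983Higgs3, (1.22) p.416] -/
def pairExt5 (φ φ' : HiggsLattice.ScalarField P 0 N) : ExtSLeg (g318a nbar hn2) → HiggsLattice.ScalarField P 0 N :=
  fun ℓ => if ℓ = ee5 nbar hn2 0 then φ else φ'

/-- `pairExt5` on the two legs. [cite: Balaban1983Higgs3, (1.22) p.416] -/
theorem pairExt5_apply (φ φ' : HiggsLattice.ScalarField P 0 N) :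
    pairExt5 (hn2 := hn2) φ φ' (ee5 nbar hn2 0) = φ ∧ pairExt5 (hn2 := hn2) φ φ' (ee5 nbar hn2 1) = φ' :=
  ⟨if_pos rfl, if_neg (Ne.symm ee5_0_ne_1)⟩

/-- **THE FIFTH TERM OF (1.22) as a bilinear form in the external fields**, on the (Higgs)₂,₃ torus carrier: print's
*"2de⁴ q²C^ε_0(x − x′)q²(C^ε(x − x′))²"* (p. 416) inserted between `φ(x)` and `φ′(x′)`: `2d·e⁴ Σ_{x,x′} ε^{2d} C₀(x,x′)C(x,x′)² φ(x)·q⁴φ′(x′)`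
(the two `q²` collected on `φ′`; two-point kernels `C₀`, `C`) — `B3Eq123Counterterms.sig5` RESTATED symbol by symbol on this carrier.
[cite: Balaban1983Higgs3, (1.22) p.416] -/
def fifth122T (ε e : ℝ) (q : HiggsCovariance.E N →L[ℝ] HiggsCovariance.E N) (C₀ C : HiggsLattice.Site P 0 → HiggsLattice.Site P 0 → ℝ)
    (φ φ' : HiggsLattice.ScalarField P 0 N) : ℝ :=
  2 * (P.d : ℝ) * e ^ 4 * ∑ x : HiggsLattice.Site P 0, ∑ x' : HiggsLattice.Site P 0,
    ε ^ (2 * P.d) * (C₀ x x' * C x x' ^ 2 * ⟪φ x, (q ^ 4) (φ' x')⟫_ℝ)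

variable [DecidableEq (HiggsLattice.PBond P 0)]

/-- **⑤ for product external fields.** [cite: Balaban1983Higgs3, (1.22) p.416] [cite: Balaban1983Higgs3, (3.18) p.438] -/
theorem graphAmp_g318a_extS (M : Model P N k) (dm2 : Fin (g318a nbar hn2).nV → HiggsLattice.Site P 0 → ℝ)
    (loc : Fin (g318a nbar hn2).nV → Loc P k) (Po : OutPairing (g318a nbar hn2))
    (Ks : SLine (g318a nbar hn2) → HiggsLattice.Site P 0 × Fin N → HiggsLattice.Site P 0 × Fin N → ℝ)
    (Kv : VLine (g318a nbar hn2) → HiggsLattice.PBond P 0 → HiggsLattice.PBond P 0 → ℝ)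
    (Ko : Po.Line oRank → HiggsLattice.Site P k × Fin N → HiggsLattice.Site P k × Fin N → ℝ)
    (φ : ExtSLeg (g318a nbar hn2) → HiggsLattice.ScalarField P 0 N) :
    graphAmp (g318a nbar hn2) M dm2 loc Po Ks Kv Ko (extS (g318a nbar hn2) φ) (fun _ => 1) (fun _ => 1) =
      (M.C.e ^ 2 / 2) ^ 2 * ∑ b ∈ M.S, ∑ b' ∈ M.S, (loc (vx5 nbar hn2 0)).wB b * (loc (vx5 nbar hn2 1)).wB b' *
        ((P.mesh 0 ^ P.d) ^ 2 * (M.g b.src ^ 2 * M.g b'.src ^ 2) * (Kv (vl5a nbar hn2) b b' * Kv (vl5b nbar hn2) b b') *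
          ∑ a : Fin N, ∑ c : Fin N, ∑ a' : Fin N, ∑ c' : Fin N,
            opCoeff (M.C.q ^ 2) a c * opCoeff (M.C.q ^ 2) a' c' * Ks (sl5 nbar hn2) (b.src, a) (b'.src, a') *
              (φ (ee5 nbar hn2 0) b.src c * φ (ee5 nbar hn2 1) b'.src c')) := by
  rw [graphAmp_g318a]
  simp only [extS_extAt5]

/-- **⑤ with the free propagators**: summing over all bonds, with site-valued localization weights `g₀`, `g₁`, the scalar line kernel
`C₀ ⊗ 1_N` and the direction-diagonal vector line kernel `δ_{μμ′}C(b₋,b′₋)` on both A-lines (READING of print's scalar kernel `C^ε` for the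
A-lines; hypotheses on the supplied kernels): the direction deltas give the factor `d`, the `q²`-brackets contract into `q²φ·q²φ′`:
`E = (e²/2)²·d·Σ_{x,x′} η^{2d} g₀(x)g₁(x′) g_k(x)²g_k(x′)² C₀(x,x′) C(x,x′)² (q²φ(x)·q²φ′(x′))`. [cite: Balaban1983Higgs3, (1.22) p.416] -/
theorem graphAmp_g318a_free (M : Model P N k) (hS : M.S = Finset.univ)
    (dm2 : Fin (g318a nbar hn2).nV → HiggsLattice.Site P 0 → ℝ) (loc : Fin (g318a nbar hn2).nV → Loc P k)
    (g₀ g₁ : HiggsLattice.Site P 0 → ℝ) (hw₀ : ∀ b, (loc (vx5 nbar hn2 0)).wB b = g₀ b.src) (hw₁ : ∀ b, (loc (vx5 nbar hn2 1)).wB b = g₁ b.src)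
    (Po : OutPairing (g318a nbar hn2)) (Ks : SLine (g318a nbar hn2) → HiggsLattice.Site P 0 × Fin N → HiggsLattice.Site P 0 × Fin N → ℝ)
    (Kv : VLine (g318a nbar hn2) → HiggsLattice.PBond P 0 → HiggsLattice.PBond P 0 → ℝ)
    (Ko : Po.Line oRank → HiggsLattice.Site P k × Fin N → HiggsLattice.Site P k × Fin N → ℝ)
    (C₀ C : HiggsLattice.Site P 0 → HiggsLattice.Site P 0 → ℝ) (hKs : ∀ l p p', Ks l p p' = if p.2 = p'.2 then C₀ p.1 p'.1 else 0)
    (hKv : ∀ l b b', Kv l b b' = if b.dir = b'.dir then C b.src b'.src else 0) (φ φ' : HiggsLattice.ScalarField P 0 N) :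
    graphAmp (g318a nbar hn2) M dm2 loc Po Ks Kv Ko (extS (g318a nbar hn2) (pairExt5 φ φ')) (fun _ => 1) (fun _ => 1) =
      (M.C.e ^ 2 / 2) ^ 2 * ((P.d : ℝ) * ∑ x : HiggsLattice.Site P 0, ∑ x' : HiggsLattice.Site P 0,
        P.mesh 0 ^ (2 * P.d) * (g₀ x * g₁ x' * (M.g x ^ 2 * M.g x' ^ 2) * (C₀ x x' * C x x' ^ 2) *
          ⟪(M.C.q ^ 2) (φ x), (M.C.q ^ 2) (φ' x')⟫_ℝ)) := by
  rw [graphAmp_g318a_extS]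
  obtain ⟨e0, e1⟩ := pairExt5_apply (hn2 := hn2) φ φ'
  simp only [e0, e1, hw₀, hw₁, hKs, hKv, hS]
  have hl : ∀ x x' : HiggsLattice.Site P 0, ∑ a : Fin N, ∑ c : Fin N, ∑ a' : Fin N, ∑ c' : Fin N,
      opCoeff (M.C.q ^ 2) a c * opCoeff (M.C.q ^ 2) a' c' * (if ((x, a) : HiggsLattice.Site P 0 × Fin N).2 = ((x', a') : HiggsLattice.Site P 0 × Fin N).2
        then C₀ ((x, a) : HiggsLattice.Site P 0 × Fin N).1 ((x', a') : HiggsLattice.Site P 0 × Fin N).1 else 0) * (φ x c * φ' x' c') =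
        C₀ x x' * ⟪(M.C.q ^ 2) (φ x), (M.C.q ^ 2) (φ' x')⟫_ℝ := fun x x' => loop_sum5 (M.C.q ^ 2) (C₀ x x') (φ x) (φ' x')
  simp only [hl]
  rw [sum_bond5]
  congr 1
  rw [Finset.mul_sum]
  refine Finset.sum_congr rfl fun x _ => ?_
  -- the direction sums: `Σ_μ Σ_{b′} [μ = μ′]C·[μ = μ′]C·(…) = d·Σ_{x′} C²·(…)`
  have h1 : ∀ μ : Fin P.d, ∑ b' : HiggsLattice.PBond P 0,
      g₀ x * g₁ b'.src * ((P.mesh 0 ^ P.d) ^ 2 * (M.g x ^ 2 * M.g b'.src ^ 2) *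
        ((if μ = b'.dir then C x b'.src else 0) * (if μ = b'.dir then C x b'.src else 0)) *
        (C₀ x b'.src * ⟪(M.C.q ^ 2) (φ x), (M.C.q ^ 2) (φ' b'.src)⟫_ℝ)) =
      ∑ x' : HiggsLattice.Site P 0, P.mesh 0 ^ (2 * P.d) * (g₀ x * g₁ x' * (M.g x ^ 2 * M.g x' ^ 2) * (C₀ x x' * C x x' ^ 2) *
        ⟪(M.C.q ^ 2) (φ x), (M.C.q ^ 2) (φ' x')⟫_ℝ) := by
    intro μ
    rw [sum_bond5]
    dsimp only
    refine Finset.sum_congr rfl fun x' _ => ?_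
    have h2 : ∀ μ' : Fin P.d,
        g₀ x * g₁ x' * ((P.mesh 0 ^ P.d) ^ 2 * (M.g x ^ 2 * M.g x' ^ 2) * ((if μ = μ' then C x x' else 0) * (if μ = μ' then C x x' else 0)) *
          (C₀ x x' * ⟪(M.C.q ^ 2) (φ x), (M.C.q ^ 2) (φ' x')⟫_ℝ)) =
        if μ = μ' then P.mesh 0 ^ (2 * P.d) * (g₀ x * g₁ x' * (M.g x ^ 2 * M.g x' ^ 2) * (C₀ x x' * C x x' ^ 2) *
          ⟪(M.C.q ^ 2) (φ x), (M.C.q ^ 2) (φ' x')⟫_ℝ) else 0 := by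
      intro μ'
      split_ifs
      · rw [pow_mul]; ring
      · ring
    rw [Finset.sum_congr rfl fun μ' _ => h2 μ', Finset.sum_ite_eq]
    simp
  dsimp only
  simp only [h1, Finset.sum_const, Finset.card_univ, Fintype.card_fin, nsmul_eq_mul]

/-- **E(⑤) IS ONE EIGHTH OF THE FIFTH TERM OF (1.22)** at print's data of p. 416 (*"B̃ = 0, g_k = 1"*, all bonds of `T_ε`, trivial
localization, `η = ε`, free propagators): `E = (1/8)·fifth122T` — the drawn labelled picture is ONE Wick term; print's coefficient `2`
against the picture's `(1/2!)²` from the two vertices (1.10)_{2,0} counts the `2·2` choices of the external leg at each vertex and the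
`2` pairings of the A-legs into two lines (`8·(1/4) = 2`); `q²…q²` collected as `q⁴` on `φ′` (`inner_sq_sq`).
[cite: Balaban1983Higgs3, (1.22) p.416] -/
theorem graphAmp_g318a_print (M : Model P N k) (hS : M.S = Finset.univ) (hg : M.g = fun _ => 1)
    (dm2 : Fin (g318a nbar hn2).nV → HiggsLattice.Site P 0 → ℝ) (loc : Fin (g318a nbar hn2).nV → Loc P k)
    (hw₀ : ∀ b, (loc (vx5 nbar hn2 0)).wB b = 1) (hw₁ : ∀ b, (loc (vx5 nbar hn2 1)).wB b = 1)
    (Po : OutPairing (g318a nbar hn2)) (Ks : SLine (g318a nbar hn2) → HiggsLattice.Site P 0 × Fin N → HiggsLattice.Site P 0 × Fin N → ℝ)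
    (Kv : VLine (g318a nbar hn2) → HiggsLattice.PBond P 0 → HiggsLattice.PBond P 0 → ℝ)
    (Ko : Po.Line oRank → HiggsLattice.Site P k × Fin N → HiggsLattice.Site P k × Fin N → ℝ)
    (C₀ C : HiggsLattice.Site P 0 → HiggsLattice.Site P 0 → ℝ) (hKs : ∀ l p p', Ks l p p' = if p.2 = p'.2 then C₀ p.1 p'.1 else 0)
    (hKv : ∀ l b b', Kv l b b' = if b.dir = b'.dir then C b.src b'.src else 0) (φ φ' : HiggsLattice.ScalarField P 0 N) :
    graphAmp (g318a nbar hn2) M dm2 loc Po Ks Kv Ko (extS (g318a nbar hn2) (pairExt5 φ φ')) (fun _ => 1) (fun _ => 1) =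
      1 / 8 * fifth122T (P.mesh 0) M.C.e M.C.q C₀ C φ φ' := by
  rw [graphAmp_g318a_free M hS dm2 loc (fun _ => 1) (fun _ => 1) (fun b => hw₀ b) (fun b => hw₁ b) Po Ks Kv Ko C₀ C hKs hKv φ φ',
    fifth122T, hg]
  simp only [one_pow, one_mul, mul_one, inner_sq_sq]
  ring

end Free5

/-! ## §10 (v1.1) ① = (3.6)₃ (`g36c`, FILE 3's closed form) at print's data: the first term of (1.22) -/

section First

variable {P : HiggsLattice.Params} {N k : ℕ}

open Literature.MathematicalPhysics.QuantumFieldTheory.Balaban1983to89.B3Sect3LowestOrderGraphs (g36b g36c)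
open Literature.MathematicalPhysics.QuantumFieldTheory.Balaban1983to89.B3Eq36TadpoleExpressions (v0 line0 e2 e3 graphAmp_g36c_extS w0 vline0 es
  graphAmp_g36b_extS)

/-- kernel: the scalar product of `W = ℝ^N` in coordinates. [folklore] -/
private theorem inner_eq_sum_coord1 (u v : HiggsCovariance.E N) : ⟪u, v⟫_ℝ = ∑ a, u a * v a := by
  rw [PiLp.inner_apply]
  simp [mul_comm]

/-- The two external fields of ①: `φ` on the leg 2, `φ′` on the leg 3 of the (1.6) vertex (FILE 3's `e2`, `e3`). [cite: Balaban1983Higgs3, (1.22) p.416] -/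
def pairExt1 (φ φ' : HiggsLattice.ScalarField P 0 N) : ExtSLeg (g36c nbar) → HiggsLattice.ScalarField P 0 N :=
  fun ℓ => if ℓ = e2 nbar then φ else φ'

/-- `pairExt1` on the two legs. [cite: Balaban1983Higgs3, (1.22) p.416] -/
theorem pairExt1_apply (φ φ' : HiggsLattice.ScalarField P 0 N) :
    pairExt1 (nbar := nbar) φ φ' (e2 nbar) = φ ∧ pairExt1 (nbar := nbar) φ φ' (e3 nbar) = φ' :=
  ⟨if_pos rfl, if_neg (Ne.symm B3Eq36TadpoleExpressions.e2_ne_e3)⟩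

/-- **THE FIRST TERM OF (1.22) as a bilinear form in the external fields**, on the (Higgs)₂,₃ torus carrier: print's
*"−4(N+2)λC^ε_0(0)δ^ε(x − x′)"* (p. 416) inserted between `φ(x)` and `φ′(x′)`, the lattice δ collapsing one sum:
`−4(N+2)λ Σ_x ε^d C₀(x,x) φ(x)·φ′(x)` — `B3Eq123Counterterms.sig1` RESTATED on this carrier. [cite: Balaban1983Higgs3, (1.22) p.416] -/
def first122T (ε lam : ℝ) (N' : ℕ) (C₀ : HiggsLattice.Site P 0 → HiggsLattice.Site P 0 → ℝ) (φ φ' : HiggsLattice.ScalarField P 0 N) : ℝ :=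
  -(4 * ((N' : ℝ) + 2) * lam * ∑ x : HiggsLattice.Site P 0, ε ^ P.d * (C₀ x x * ⟪φ x, φ' x⟫_ℝ))

variable [DecidableEq (HiggsLattice.PBond P 0)]

/-- **① with the free scalar propagator** (FILE 3's `graphAmp_g36c_extS` with `Ks = C₀ ⊗ 1_N`): the φ′-loop at the (1.6) vertex gives the
trace `N·C₀(x,x)`: `E = −λ·N·Σ_{x∈Ω₁} w(x) η^d C₀(x,x) φ(x)·φ′(x)`. [cite: Balaban1983Higgs3, (1.22) p.416] -/
theorem graphAmp_g36c_free (M : Model P N k) (dm2 : Fin (g36c nbar).nV → HiggsLattice.Site P 0 → ℝ) (loc : Fin (g36c nbar).nV → Loc P k)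
    (Po : OutPairing (g36c nbar)) (Ks : SLine (g36c nbar) → HiggsLattice.Site P 0 × Fin N → HiggsLattice.Site P 0 × Fin N → ℝ)
    (Kv : VLine (g36c nbar) → HiggsLattice.PBond P 0 → HiggsLattice.PBond P 0 → ℝ)
    (Ko : Po.Line oRank → HiggsLattice.Site P k × Fin N → HiggsLattice.Site P k × Fin N → ℝ)
    (C₀ : HiggsLattice.Site P 0 → HiggsLattice.Site P 0 → ℝ) (hKs : ∀ l p p', Ks l p p' = if p.2 = p'.2 then C₀ p.1 p'.1 else 0)
    (φ φ' : HiggsLattice.ScalarField P 0 N) :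
    graphAmp (g36c nbar) M dm2 loc Po Ks Kv Ko (extS (g36c nbar) (pairExt1 φ φ')) (fun _ => 1) (fun _ => 1) =
      -(M.lamRun * ((N : ℝ) * ∑ x ∈ M.Ω₁, (loc (v0 nbar)).wS x * (P.mesh 0 ^ P.d * (C₀ x x * ⟪φ x, φ' x⟫_ℝ)))) := by
  rw [graphAmp_g36c_extS]
  obtain ⟨e0, e1⟩ := pairExt1_apply (nbar := nbar) φ φ'
  simp only [e0, e1, hKs, if_true, Finset.sum_const, Finset.card_univ, Fintype.card_fin, nsmul_eq_mul]
  congr 1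
  simp only [Finset.mul_sum]
  exact Finset.sum_congr rfl fun x _ => by ring

/-- **E(①) AGAINST THE FIRST TERM OF (1.22)** at print's data (`Ω₁ = T_ε`, trivial localization, `η = ε`, `C₀ ⊗ 1_N`):
`E = (N/(4(N+2)))·first122T` — p18's drawing `g36c` joins the legs 0, 1 of ONE scalar product of (1.6) (a closed index loop, factor `N`);
print's `4(N+2) = 4N + 8` is consistent with counting the ordered choices of the two external legs: `4` from one scalar product (loop on
the other, factor `N`) and `8` across the two products (one index chain) — a reading note; signs agree (`−λ`). [cite: Balaban1983Higgs3, (1.22) p.416] -/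
theorem graphAmp_g36c_print (M : Model P N k) (hΩ : M.Ω₁ = Finset.univ) (dm2 : Fin (g36c nbar).nV → HiggsLattice.Site P 0 → ℝ)
    (loc : Fin (g36c nbar).nV → Loc P k) (hw : ∀ x, (loc (v0 nbar)).wS x = 1) (Po : OutPairing (g36c nbar))
    (Ks : SLine (g36c nbar) → HiggsLattice.Site P 0 × Fin N → HiggsLattice.Site P 0 × Fin N → ℝ)
    (Kv : VLine (g36c nbar) → HiggsLattice.PBond P 0 → HiggsLattice.PBond P 0 → ℝ)
    (Ko : Po.Line oRank → HiggsLattice.Site P k × Fin N → HiggsLattice.Site P k × Fin N → ℝ)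
    (C₀ : HiggsLattice.Site P 0 → HiggsLattice.Site P 0 → ℝ) (hKs : ∀ l p p', Ks l p p' = if p.2 = p'.2 then C₀ p.1 p'.1 else 0)
    (φ φ' : HiggsLattice.ScalarField P 0 N) :
    graphAmp (g36c nbar) M dm2 loc Po Ks Kv Ko (extS (g36c nbar) (pairExt1 φ φ')) (fun _ => 1) (fun _ => 1) =
      (N : ℝ) / (4 * ((N : ℝ) + 2)) * first122T (P.mesh 0) M.lamRun N C₀ φ φ' := by
  rw [graphAmp_g36c_free M dm2 loc Po Ks Kv Ko C₀ hKs φ φ', first122T, hΩ]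
  simp only [hw, one_mul]
  have hN : (4 : ℝ) * ((N : ℝ) + 2) ≠ 0 := by positivity
  rw [div_mul_eq_mul_div, eq_div_iff hN]
  ring

end First

/-! ## §11 (v1.1) ② = (3.6)₂ (`g36b`, FILE 3's closed form) at print's data: the second term of (1.22) -/

section Second

variable {P : HiggsLattice.Params} {N k : ℕ} {hn2 : 2 ≤ nbar}

open Literature.MathematicalPhysics.QuantumFieldTheory.Balaban1983to89.B3Sect3LowestOrderGraphs (g36b)
open Literature.MathematicalPhysics.QuantumFieldTheory.Balaban1983to89.B3Eq36TadpoleExpressions (w0 vline0 es graphAmp_g36b_extS)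

/-- kernel: a sum over the positively oriented bonds is the sum over initial points and directions. [folklore] -/
private theorem sum_bond2 {j : ℕ} (F : HiggsLattice.PBond P j → ℝ) :
    ∑ b, F b = ∑ x : HiggsLattice.Site P j, ∑ μ : Fin P.d, F ⟨x, μ⟩ := by
  let e : HiggsLattice.Site P j × Fin P.d ≃ HiggsLattice.PBond P j :=
    ⟨fun p => ⟨p.1, p.2⟩, fun b => (b.src, b.dir), fun _ => rfl, fun _ => rfl⟩
  rw [← Fintype.sum_equiv e (fun p => F ⟨p.1, p.2⟩) F fun _ => rfl, Fintype.sum_prod_type]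

/-- The two external fields of ②: `φ` on the leg 0, `φ′` on the leg 1 of the (1.10)_{2,0} vertex (FILE 3's `es 0`, `es 1`).
[cite: Balaban1983Higgs3, (1.22) p.416] -/
def pairExt2 (φ φ' : HiggsLattice.ScalarField P 0 N) : ExtSLeg (g36b nbar hn2) → HiggsLattice.ScalarField P 0 N :=
  fun ℓ => if ℓ = es nbar hn2 0 then φ else φ'

/-- `pairExt2` on the two legs. [cite: Balaban1983Higgs3, (1.22) p.416] -/
theorem pairExt2_apply (φ φ' : HiggsLattice.ScalarField P 0 N) :
    pairExt2 (hn2 := hn2) φ φ' (es nbar hn2 0) = φ ∧ pairExt2 (hn2 := hn2) φ φ' (es nbar hn2 1) = φ' :=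
  ⟨if_pos rfl, if_neg (Ne.symm B3Eq36TadpoleExpressions.es0_ne_es1)⟩

/-- **THE SECOND TERM OF (1.22) as a bilinear form in the external fields**, on the (Higgs)₂,₃ torus carrier: print's
*"e²dC^ε(0)q²δ^ε(x − x′)"* (p. 416) inserted between `φ(x)` and `φ′(x′)`: `e²·d·Σ_x ε^d C(x,x) φ(x)·q²φ′(x)` (`q²` the operator) —
`B3Eq123Counterterms.sig2` RESTATED on this carrier. [cite: Balaban1983Higgs3, (1.22) p.416] -/
def second122T (ε e : ℝ) (q : HiggsCovariance.E N →L[ℝ] HiggsCovariance.E N) (C : HiggsLattice.Site P 0 → HiggsLattice.Site P 0 → ℝ)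
    (φ φ' : HiggsLattice.ScalarField P 0 N) : ℝ :=
  e ^ 2 * (P.d : ℝ) * ∑ x : HiggsLattice.Site P 0, ε ^ P.d * (C x x * ⟪φ x, (q ^ 2) (φ' x)⟫_ℝ)

variable [DecidableEq (HiggsLattice.PBond P 0)]

/-- **② with the free vector propagator** (FILE 3's `graphAmp_g36b_extS`, all bonds, site weight `g₀`, `Kv = δ_{μμ′}C(b₋,b′₋)`): the A′-loop
gives `C(x,x)` and the direction sum the factor `d`: `E = (e²/2)·d·Σ_x η^d g₀(x)g_k(x)² C(x,x) φ(x)·q²φ′(x)`. [cite: Balaban1983Higgs3, (1.22) p.416] -/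
theorem graphAmp_g36b_free (M : Model P N k) (hS : M.S = Finset.univ) (dm2 : Fin (g36b nbar hn2).nV → HiggsLattice.Site P 0 → ℝ)
    (loc : Fin (g36b nbar hn2).nV → Loc P k) (g₀ : HiggsLattice.Site P 0 → ℝ) (hw : ∀ b, (loc (w0 nbar hn2)).wB b = g₀ b.src)
    (Po : OutPairing (g36b nbar hn2)) (Ks : SLine (g36b nbar hn2) → HiggsLattice.Site P 0 × Fin N → HiggsLattice.Site P 0 × Fin N → ℝ)
    (Kv : VLine (g36b nbar hn2) → HiggsLattice.PBond P 0 → HiggsLattice.PBond P 0 → ℝ)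
    (Ko : Po.Line oRank → HiggsLattice.Site P k × Fin N → HiggsLattice.Site P k × Fin N → ℝ)
    (C : HiggsLattice.Site P 0 → HiggsLattice.Site P 0 → ℝ) (hKv : ∀ l b b', Kv l b b' = if b.dir = b'.dir then C b.src b'.src else 0)
    (φ φ' : HiggsLattice.ScalarField P 0 N) :
    graphAmp (g36b nbar hn2) M dm2 loc Po Ks Kv Ko (extS (g36b nbar hn2) (pairExt2 φ φ')) (fun _ => 1) (fun _ => 1) =
      M.C.e ^ 2 / 2 * ((P.d : ℝ) * ∑ x : HiggsLattice.Site P 0,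
        P.mesh 0 ^ P.d * (g₀ x * M.g x ^ 2 * C x x * ⟪φ x, (M.C.q ^ 2) (φ' x)⟫_ℝ)) := by
  rw [graphAmp_g36b_extS]
  obtain ⟨e0, e1⟩ := pairExt2_apply (hn2 := hn2) φ φ'
  simp only [e0, e1, hw, hKv, hS, if_true]
  rw [sum_bond2]
  congr 1
  have h1 : ∀ x : HiggsLattice.Site P 0, ∑ μ : Fin P.d,
      g₀ x * (P.mesh 0 ^ P.d * M.g x ^ 2 * C x x * ⟪φ x, (M.C.q ^ 2) (φ' x)⟫_ℝ) =
        (P.d : ℝ) * (P.mesh 0 ^ P.d * (g₀ x * M.g x ^ 2 * C x x * ⟪φ x, (M.C.q ^ 2) (φ' x)⟫_ℝ)) := by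
    intro x
    rw [Finset.sum_const, Finset.card_univ, Fintype.card_fin, nsmul_eq_mul]
    ring
  simp only [h1, ← Finset.mul_sum]

/-- **E(②) IS ONE HALF OF THE SECOND TERM OF (1.22)** at print's data (`g_k = 1`, all bonds of `T_ε`, trivial localization, `η = ε`):
`E = (1/2)·second122T` — the picture's `1/2!` of (1.10)_{2,0} against print's two assignments of the external legs (reading note).
[cite: Balaban1983Higgs3, (1.22) p.416] -/
theorem graphAmp_g36b_print (M : Model P N k) (hS : M.S = Finset.univ) (hg : M.g = fun _ => 1)
    (dm2 : Fin (g36b nbar hn2).nV → HiggsLattice.Site P 0 → ℝ) (loc : Fin (g36b nbar hn2).nV → Loc P k)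
    (hw : ∀ b, (loc (w0 nbar hn2)).wB b = 1) (Po : OutPairing (g36b nbar hn2))
    (Ks : SLine (g36b nbar hn2) → HiggsLattice.Site P 0 × Fin N → HiggsLattice.Site P 0 × Fin N → ℝ)
    (Kv : VLine (g36b nbar hn2) → HiggsLattice.PBond P 0 → HiggsLattice.PBond P 0 → ℝ)
    (Ko : Po.Line oRank → HiggsLattice.Site P k × Fin N → HiggsLattice.Site P k × Fin N → ℝ)
    (C : HiggsLattice.Site P 0 → HiggsLattice.Site P 0 → ℝ) (hKv : ∀ l b b', Kv l b b' = if b.dir = b'.dir then C b.src b'.src else 0)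
    (φ φ' : HiggsLattice.ScalarField P 0 N) :
    graphAmp (g36b nbar hn2) M dm2 loc Po Ks Kv Ko (extS (g36b nbar hn2) (pairExt2 φ φ')) (fun _ => 1) (fun _ => 1) =
      1 / 2 * second122T (P.mesh 0) M.C.e M.C.q C φ φ' := by
  rw [graphAmp_g36b_free M hS dm2 loc (fun _ => 1) (fun b => hw b) Po Ks Kv Ko C hKv φ φ', second122T, hg]
  simp only [one_pow, one_mul, mul_one]
  ring

end Second

/-! ## §12 (v1.2) ④ = (3.6)₁ = (3.8) (`g36a`, FILE 5's free form) at print's data: the fourth term of (1.22) -/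

section Fourth

variable {P : HiggsLattice.Params} {N k : ℕ} {hn : 1 ≤ nbar}

open Literature.MathematicalPhysics.QuantumFieldTheory.Balaban1983to89.B3Sect3LowestOrderGraphs (g36a)
open Literature.MathematicalPhysics.QuantumFieldTheory.Balaban1983to89.B3Eq39FromFeynmanRules (vtx sline vline pairExt dKernelT coeff39T
  graphTerm39T graphAmp_g36a_free)

/-- **THE FOURTH TERM OF (1.22) as a bilinear form in the external fields**, on the (Higgs)₂,₃ torus carrier: print's
*"− e²Σ_{μ=1}^d q(∂^ε_μC^ε_0∂^{ε*}_μ)(x − x′)qC^ε(x − x′)"* (p. 416) inserted between `φ(x)` and `φ′(x′)`: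
`−e² Σ_{x,x′} ε^{2d} [Σ_μ (∂^ε_μC₀∂^{ε*}_μ)(x,x′)]·C(x,x′)·φ(x)·q²φ′(x′)` (the four-term difference kernel of FILE 5's `dKernelT`, `qq` as the
operator `q²` — `q·Kq` between the fields) — `B3Eq123Counterterms.sig4` RESTATED on this carrier; the same expression as print's (3.9) first
term (p. 435) with `G_{(j)}(0) ↦ C^ε_0`, `G_{(j′)} ↦ C^ε`, `g = g′ = 1`. [cite: Balaban1983Higgs3, (1.22) p.416] -/
def fourth122T (ε e : ℝ) (q : HiggsCovariance.E N →L[ℝ] HiggsCovariance.E N) (C₀ C : HiggsLattice.Site P 0 → HiggsLattice.Site P 0 → ℝ)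
    (φ φ' : HiggsLattice.ScalarField P 0 N) : ℝ :=
  -(e ^ 2 * ∑ x : HiggsLattice.Site P 0, ∑ x' : HiggsLattice.Site P 0,
    ε ^ (2 * P.d) * ((∑ μ : Fin P.d, dKernelT ε⁻¹ μ C₀ x x') * C x x' * ⟪φ x, q (q (φ' x'))⟫_ℝ))

variable [DecidableEq (HiggsLattice.PBond P 0)]

/-- **E(④) IS THE FOURTH TERM OF (1.22)** at print's data of p. 416 (`B̃ = 0`, `g_k = 1`, all bonds, trivial localization, `η = ε`,
`C^ε_0 ⊗ 1_N` on the φ-line, `δ_{μμ′}C^ε` on the A-line): `E = fourth122T` — FILE 5's `graphAmp_g36a_free` (`= −e²·graphTerm39T`) read at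
`g₀ = g₁ = g_k = 1`; coefficient ONE (the two vertices (1.8)_{1,0} carry `(−e)·(−e) = e²` and the sign of (3.9)). [cite: Balaban1983Higgs3, (1.22) p.416]
[cite: Balaban1983Higgs3, (3.9) p.435] -/
theorem graphAmp_g36a_print (M : Model P N k) (hB : M.B = 0) (hS : M.S = Finset.univ) (hg : M.g = fun _ => 1)
    (dm2 : Fin (g36a nbar hn).nV → HiggsLattice.Site P 0 → ℝ) (loc : Fin (g36a nbar hn).nV → Loc P k)
    (hw₀ : ∀ b, (loc (vtx nbar hn 0)).wB b = 1) (hw₁ : ∀ b, (loc (vtx nbar hn 1)).wB b = 1)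
    (Po : OutPairing (g36a nbar hn)) (Ks : SLine (g36a nbar hn) → HiggsLattice.Site P 0 × Fin N → HiggsLattice.Site P 0 × Fin N → ℝ)
    (Kv : VLine (g36a nbar hn) → HiggsLattice.PBond P 0 → HiggsLattice.PBond P 0 → ℝ)
    (Ko : Po.Line oRank → HiggsLattice.Site P k × Fin N → HiggsLattice.Site P k × Fin N → ℝ)
    (C₀ C : HiggsLattice.Site P 0 → HiggsLattice.Site P 0 → ℝ)
    (hKs : ∀ p p', Ks (sline nbar hn) p p' = if p.2 = p'.2 then C₀ p.1 p'.1 else 0)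
    (hKv : ∀ b b', Kv (vline nbar hn) b b' = if b.dir = b'.dir then C b.src b'.src else 0) (φ φ' : HiggsLattice.ScalarField P 0 N) :
    graphAmp (g36a nbar hn) M dm2 loc Po Ks Kv Ko (extS (g36a nbar hn) (pairExt φ φ')) (fun _ => 1) (fun _ => 1) =
      fourth122T (P.mesh 0) M.C.e M.C.q C₀ C φ φ' := by
  rw [graphAmp_g36a_free M hB hS dm2 loc (fun _ => 1) (fun _ => 1) (fun b => hw₀ b) (fun b => hw₁ b) Po Ks Kv Ko C₀ C hKs hKv φ φ',
    fourth122T, graphTerm39T, hg]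
  simp only [coeff39T, mul_one]

end Fourth











end

end Literature.MathematicalPhysics.QuantumFieldTheory.Balaban1983to89.B3Eq122FromFeynmanRules
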